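import Literature.Analysis.FluidPDE.Tao2016AveragedNS.SelfSimilarCascadeBlowup

/-!
# Tao 2016, §4–§6: rigidity and residues of S-topology profile systems — THEOREMS A, B, B′, B″
# for admissible travelling / discretely self-similar cascade waves (LEMMA LAYER, second part)

T. Tao, *Finite time blowup for an averaged three-dimensional Navier–Stokes equation*, J. Amer.
Math. Soc. **29** (2016) 601–674 = arXiv:1402.0290v3 [`Tao2016AveragedNS`]: §4 (structure
constants on the shift set `S`, symmetry (4.2) and cancellation (4.3), the cascade ODE (4.8) and
its energy identity (4.9)–(4.10)), §5 (the four-mode circuit: pump, amplifier, rotor, rectifier)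
and §6 (Theorem 6.6's table; §6.4 the energy bookkeeping of the self-similar blow-up).

This module proves, over the vocabulary of `RenormalisedCascadeWaves` (`STable`, `IsSWave`,
`sFlux`, `IsTW`, `sEnergy`, `sMass`, `wEnergy`, `IsDSSWave`, `dssAction`, `dssMu`, table maps
`tableQ/tableA/tableB`, `fluxConst`) and of `SelfSimilarCascadeBlowup` (elementary lemmas), the
RIGIDITY THEOREMS of the cell harvest/h2-tao-ladder for profile families of an abstract S-table
`(Q, A, B, C_A)` — energy-neutral intra-shell part, cancelling feed/back-reaction pair, outflow
quadratic in the emitting shell: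

* scalar cores (pure real analysis): a non-negative `C¹` function obeying a WAVE IDENTITY
  `e' = 2(f(·+T) − f)` with `|f| ≤ C g e`, `g` integrable, that vanishes on a window of length `T`
  vanishes identically to the left (`eventually_zero_of_wave_identity`, weighted version); a
  backward comparison lemma for `|e'| ≤ a e(·+T) + b e` window by window (`backward_comparison`);
  the effective bound `e ≤ exp(2C(|c₁|+|c₂|)∫g)·lim e` (`le_exp_mul_lim_of_weighted_wave_identity`)
  and the existence of the limit (`tendsto_of_weighted_wave_identity_of_bdd`).
* **THEOREM A / B** for S-waves (`IsSWave π Q A B d c₁ c₂ T Φ`, any period, any real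
  `d, c₁, c₂`, `T > 0`): the summed energy identity (`hasDerivAt_sEnergy`:
  `(Σ‖Φ_r‖²)' = −2dΣ‖Φ_r‖² + 2(c₁·sFlux(·+T) − c₂·sFlux)`), the flux bound
  `|sFlux| ≤ C_A (Σ‖Φ_r‖)(Σ‖Φ_r‖²)`, and RIGIDITY: a wave that vanishes eventually
  (`IsSWave.eq_zero_of_eventually_zero`), or whose trailing edge decays integrably
  (`eq_zero_of_trailing_decay`), or whose weighted energy has residue `0` at `+∞`
  (`eq_zero_of_zero_residue`) is identically `0`; the single-profile (`IsTW`) corollaries.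
* **THEOREM B′** (`IsSWave.theoremBprime`): with integrable mass and weighted energy bounded on a
  half-line, the RESIDUE LEVEL `Rsq = lim e^{2dx}Σ‖Φ_r x‖²` exists, bounds the whole weighted
  energy profile up to the ACTION factor `exp(2C_A(|c₁|e^{−2dT} + |c₂|)∫Σ‖Φ_r‖)`, and is positive
  unless `Φ ≡ 0`.
* Tao's four-mode CIRCUIT table (§5–§6) is an S-table (`circ_sTable`, with `C_A = |k|`), hence
  carries no periodic wave, no zero-residue cascade, and obeys B′ (`tao_circuit_*`).
* every CANCELLING structure-constant table `α` on `S` is an S-table with `C_A = fluxConst α`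
  (`table_sTable`; `fluxConst_le_of_abs_le_one`).
* FRONT SUMS `Σ_{k ≤ K} μ^k e(x + kT)` of a profile (`frontSum`) and the elementary bound
  `Rsq/(1−μ) ≤ M` from bounded front sums (`residue_div_le_of_frontSum_le`).
* **THEOREM B′ for admissible DSS waves of a cancelling table** (`IsDSSWave.theoremBprime`) and
  **THEOREM B″** (`IsDSSWave.width_lower_bound`): a sub-unitary admissible DSS wave with front
  sums `≤ M` has `Rsq/(1−μ) ≤ M` — an `(S_a)`-surviving wave is at least `≈ e^{−H}/(aε₀)` shells
  wide.

MODEL statements about lattice profile equations; NOTHING here concerns the Navier–Stokes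
equations, and nothing is asserted about which tables carry waves.  No instances, no notation.
Cell provenance: ThmA_core.lean (g4), ThmAB_general_v3…v12.lean (g5–g6) Parts 0–2, 4, 3, 5,
5.3, 5.5, 5.7, kernel-checked there; re-based here on the tree's definitions (identical bodies).
-/

noncomputable section

open Set MeasureTheory intervalIntegral Filter Topology
open scoped RealInnerProductSpace

namespace Literature.Analysis.FluidPDE

namespace TaoCascade

/-! ## Part 0.  The `λ = 1` scalar core of theory-2 g4 (ThmA_core.lean 783a4cad03f0dea4, verbatim) -/


/-- Doubling lemma: a function bounded above on `[s₁, ∞)` which, at every point of that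
half-line, is at most half of some later value, is `≤ 0` there.
[cite: Tao2016AveragedNS, §4 Lemma 4.1 (4.9)–(4.10) (energy identity of a cascade, scalar form); cell theorem (real analysis)] -/
theorem nonpos_of_doubling {e : ℝ → ℝ} {s₁ B : ℝ}
    (hB : ∀ s ≥ s₁, e s ≤ B)
    (hdbl : ∀ s ≥ s₁, ∃ σ ≥ s, 2 * e s ≤ e σ) :
    ∀ s ≥ s₁, e s ≤ 0 := by
  intro s hs
  by_contra hpos
  push Not at hpos
  -- iterate the doubling
  have iter : ∀ j : ℕ, ∃ σ ≥ s, 2 ^ j * e s ≤ e σ := by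
    intro j
    induction j with
    | zero => exact ⟨s, le_rfl, by simp⟩
    | succ j ih =>
      obtain ⟨σ, hσs, hσ⟩ := ih
      obtain ⟨σ', hσ'σ, hσ'⟩ := hdbl σ (le_trans hs hσs)
      refine ⟨σ', le_trans hσs hσ'σ, ?_⟩
      calc 2 ^ (j + 1) * e s = 2 * (2 ^ j * e s) := by ring
        _ ≤ 2 * e σ := by linarith
        _ ≤ e σ' := hσ'
  obtain ⟨j, hj⟩ := pow_unbounded_of_one_lt (B / e s) (by norm_num : (1:ℝ) < 2)
  obtain ⟨σ, hσs, hσ⟩ := iter j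
  have h1 : B < 2 ^ j * e s := by
    have := (div_lt_iff₀ hpos).mp hj
    linarith
  have h2 : e σ ≤ B := hB σ (le_trans hs hσs)
  linarith

/-- **Theorem A, analytic core.**  See the module docstring.
[cite: Tao2016AveragedNS, §4 Lemma 4.1 (4.9)–(4.10) (energy identity of a cascade, scalar form); cell theorem (real analysis)] -/
theorem eventually_zero_of_wave_identity
    {e f g : ℝ → ℝ} {T C : ℝ} (hT : 0 < T) (hC : 0 ≤ C)
    (he_cont : Continuous e) (hf_cont : Continuous f)
    (he_nn : ∀ s, 0 ≤ e s) (hg_nn : ∀ s, 0 ≤ g s)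
    (hderiv : ∀ s, HasDerivAt e (2 * (f (s + T) - f s)) s)
    (hflux : ∀ σ, |f σ| ≤ C * e σ * g (σ - T))
    (he_lim : Tendsto e atTop (𝓝 0)) (hf_lim : Tendsto f atTop (𝓝 0))
    (hg_lim : Tendsto g atTop (𝓝 0)) :
    ∃ s₀, ∀ s ≥ s₀, e s = 0 := by
  -- window integral
  set I : ℝ → ℝ := fun a => ∫ x in a..a + T, f x with hI
  have hfi : ∀ a b, IntervalIntegrable f MeasureTheory.volume a b :=
    fun a b => hf_cont.intervalIntegrable a b
  -- (★) e S - e s = 2 (I S - I s)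
  have star : ∀ s S, e S - e s = 2 * (I S - I s) := by
    intro s S
    have hd : ∀ x ∈ uIcc s S, HasDerivAt e (2 * (f (x + T) - f x)) x := fun x _ => hderiv x
    have hcont' : Continuous fun x => 2 * (f (x + T) - f x) := by
      have : Continuous fun x => f (x + T) := hf_cont.comp (continuous_id.add continuous_const)
      exact continuous_const.mul (this.sub hf_cont)
    have h1 := integral_eq_sub_of_hasDerivAt hd (hcont'.intervalIntegrable s S)
    have h2 : (∫ x in s..S, 2 * (f (x + T) - f x)) =
        2 * ((∫ x in s..S, f (x + T)) - ∫ x in s..S, f x) := by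
      rw [intervalIntegral.integral_const_mul, intervalIntegral.integral_sub]
      · exact (hf_cont.comp (continuous_id.add continuous_const)).intervalIntegrable s S
      · exact hfi s S
    have h3 : (∫ x in s..S, f (x + T)) = ∫ x in s + T..S + T, f x :=
      intervalIntegral.integral_comp_add_right f T
    have h4 : (∫ x in s..S, f x) = (∫ x in s..s + T, f x) + ∫ x in s + T..S, f x :=
      (integral_add_adjacent_intervals (hfi _ _) (hfi _ _)).symm
    have h5 : (∫ x in s + T..S + T, f x) = (∫ x in s + T..S, f x) + ∫ x in S..S + T, f x :=
      (integral_add_adjacent_intervals (hfi _ _) (hfi _ _)).symm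
    rw [← h1, h2, h3, h4, h5]
    simp only [hI]
    ring
  -- I S → 0
  have hI_lim : Tendsto I atTop (𝓝 0) := by
    rw [Metric.tendsto_atTop]
    intro ε hε
    have hε' : 0 < ε / (2 * T) := by positivity
    obtain ⟨R, hR⟩ := Filter.eventually_atTop.mp
      ((Metric.tendsto_atTop.mp hf_lim) (ε / (2 * T)) hε' |> fun ⟨N, hN⟩ =>
        Filter.eventually_atTop.mpr ⟨N, hN⟩)
    refine ⟨R, fun S hS => ?_⟩
    have hbound : ∀ x ∈ Set.uIoc S (S + T), ‖f x‖ ≤ ε / (2 * T) := by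
      intro x hx
      have hx' : S ≤ x := by
        rw [uIoc_of_le (by linarith)] at hx
        exact le_of_lt hx.1
      have := hR x (le_trans hS hx')
      rw [dist_zero_right] at this
      exact le_of_lt this
    have := norm_integral_le_of_norm_le_const hbound
    rw [dist_zero_right]
    calc ‖I S‖ ≤ ε / (2 * T) * |S + T - S| := this
      _ = ε / 2 := by rw [show S + T - S = T by ring, abs_of_pos hT]; field_simp
      _ < ε := by linarith
  -- e s = 2 I s
  have e_eq : ∀ s, e s = 2 * I s := by
    intro s
    have h1 : Tendsto (fun S => e S - 2 * (I S - I s)) atTop (𝓝 (0 - 2 * (0 - I s))) :=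
      he_lim.sub ((hI_lim.sub tendsto_const_nhds).const_mul 2)
    have h2 : (fun S => e S - 2 * (I S - I s)) = fun _ => e s := by
      funext S; have := star s S; linarith
    rw [h2] at h1
    have := tendsto_nhds_unique (tendsto_const_nhds) h1
    linarith
  -- choose η and s₁
  set η : ℝ := 1 / (4 * C * T + 4) with hη
  have hη_pos : 0 < η := by rw [hη]; positivity
  have hη_small : 2 * C * η * T ≤ 1 / 2 := by
    rw [hη]
    have h4 : 0 < 4 * C * T + 4 := by positivity
    rw [show 2 * C * (1 / (4 * C * T + 4)) * T = (2 * C * T) / (4 * C * T + 4) by field_simp]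
    rw [div_le_iff₀ h4]
    nlinarith
  obtain ⟨Rg, hRg⟩ : ∃ R, ∀ x ≥ R, g x ≤ η := by
    obtain ⟨N, hN⟩ := (Metric.tendsto_atTop.mp hg_lim) η hη_pos
    refine ⟨N, fun x hx => ?_⟩
    have := hN x hx
    rw [dist_zero_right, Real.norm_eq_abs, abs_of_nonneg (hg_nn x)] at this
    exact le_of_lt this
  set s₁ := Rg + T with hs₁
  -- doubling on [s₁, ∞)
  have hdbl : ∀ s ≥ s₁, ∃ σ ≥ s, 2 * e s ≤ e σ := by
    intro s hs
    -- max of e on [s, s+T]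
    obtain ⟨σ, hσmem, hσmax⟩ := (isCompact_Icc (a := s) (b := s + T)).exists_isMaxOn
      (nonempty_Icc.mpr (by linarith)) he_cont.continuousOn
    refine ⟨σ, hσmem.1, ?_⟩
    set M := e σ with hM
    have hMnn : 0 ≤ M := he_nn σ
    have hbound : ∀ x ∈ Set.uIoc s (s + T), ‖f x‖ ≤ C * η * M := by
      intro x hx
      rw [uIoc_of_le (by linarith)] at hx
      have hxI : x ∈ Icc s (s + T) := ⟨le_of_lt hx.1, hx.2⟩
      have hex : e x ≤ M := hσmax hxI
      have hgx : g (x - T) ≤ η := hRg (x - T) (by rw [hs₁] at hs; linarith [hx.1])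
      rw [Real.norm_eq_abs]
      calc |f x| ≤ C * e x * g (x - T) := hflux x
        _ ≤ C * M * η := by
          apply mul_le_mul (mul_le_mul_of_nonneg_left hex hC) hgx (hg_nn _) (by positivity)
        _ = C * η * M := by ring
    have hIs : ‖I s‖ ≤ C * η * M * |s + T - s| := norm_integral_le_of_norm_le_const hbound
    rw [show s + T - s = T by ring, abs_of_pos hT, Real.norm_eq_abs] at hIs
    have : I s ≤ C * η * M * T := le_trans (le_abs_self _) hIs
    calc 2 * e s = 4 * I s := by rw [e_eq s]; ring
      _ ≤ 4 * (C * η * M * T) := by linarith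
      _ = 2 * (2 * C * η * T) * M := by ring
      _ ≤ 2 * (1 / 2) * M := by
          apply mul_le_mul_of_nonneg_right _ hMnn
          linarith
      _ = M := by ring
  -- boundedness on [s₁, ∞)
  obtain ⟨Re, hRe⟩ : ∃ R, ∀ x ≥ R, e x ≤ 1 := by
    obtain ⟨N, hN⟩ := (Metric.tendsto_atTop.mp he_lim) 1 one_pos
    refine ⟨N, fun x hx => ?_⟩
    have := hN x hx
    rw [dist_zero_right, Real.norm_eq_abs, abs_of_nonneg (he_nn x)] at this
    exact le_of_lt this
  obtain ⟨B₁, hB₁⟩ : ∃ B₁, ∀ x ∈ Icc s₁ (max s₁ Re), e x ≤ B₁ := by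
    obtain ⟨x₀, _, hx₀⟩ := (isCompact_Icc (a := s₁) (b := max s₁ Re)).exists_isMaxOn
      (nonempty_Icc.mpr (le_max_left _ _)) he_cont.continuousOn
    exact ⟨e x₀, fun x hx => hx₀ hx⟩
  have hB : ∀ s ≥ s₁, e s ≤ max B₁ 1 := by
    intro s hs
    by_cases h : s ≤ max s₁ Re
    · exact le_trans (hB₁ s ⟨hs, h⟩) (le_max_left _ _)
    · push Not at h
      exact le_trans (hRe s (le_trans (le_max_right _ _) (le_of_lt h))) (le_max_right _ _)
  refine ⟨s₁, fun s hs => le_antisymm (nonpos_of_doubling hB hdbl s hs) (he_nn s)⟩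



/-! ## Part 1.  Weighted scalar core (theory-2 g5): lopsided identity `e' = 2 (c₁ f(·+T) − c₂ f)` -/

/-- **Weighted core.**  `e, g ≥ 0`, `e, f` continuous, the exact identity
`e' s = 2 (c₁ f (s+T) − c₂ f s)`, the S-flux bound `|f σ| ≤ C · e σ · g (σ−T)`, `e → 0` at `+∞`
and integrability of `σ ↦ g (σ − T)` on a half-line force `e ≡ 0` on a half-line.
(No sign or size condition on `c₁, c₂`; for `c₁ = c₂` WITHOUT integrability see Part 0.)
Proof: `e s = 2 (c₂ ∫_{s}^{∞} f − c₁ ∫_{s+T}^{∞} f)`; both tails are `≤ C · (sup e) · (tail of g)`;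
evaluate at a maximiser of `e` on the half-line.
[cite: Tao2016AveragedNS, §4 Lemma 4.1 (4.9)–(4.10) (energy identity of a cascade, scalar form); cell theorem (real analysis)] -/
theorem eventually_zero_of_weighted_wave_identity
    {e f g : ℝ → ℝ} {T C c₁ c₂ a : ℝ} (hT : 0 < T) (hC : 0 ≤ C)
    (he_cont : Continuous e) (hf_cont : Continuous f)
    (he_nn : ∀ s, 0 ≤ e s) (hg_nn : ∀ s, 0 ≤ g s)
    (hderiv : ∀ s, HasDerivAt e (2 * (c₁ * f (s + T) - c₂ * f s)) s)
    (hflux : ∀ σ, |f σ| ≤ C * e σ * g (σ - T))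
    (he_lim : Tendsto e atTop (𝓝 0))
    (hg_int : IntegrableOn (fun σ => g (σ - T)) (Ioi a)) :
    ∃ s₀, ∀ s ≥ s₀, e s = 0 := by
  -- (1) `e ≤ 1` beyond `Re`
  obtain ⟨Re, hRe⟩ : ∃ R, ∀ x ≥ R, e x ≤ 1 := by
    obtain ⟨N, hN⟩ := (Metric.tendsto_atTop.mp he_lim) 1 one_pos
    refine ⟨N, fun x hx => ?_⟩
    have := hN x hx
    rw [dist_zero_right, Real.norm_eq_abs, abs_of_nonneg (he_nn x)] at this
    exact le_of_lt this
  set R₀ := max Re a with hR₀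
  -- (2) `f` is integrable on `(R₀, ∞)`
  have hfi : IntegrableOn f (Ioi R₀) := by
    have hgi : Integrable (fun σ => C * g (σ - T)) (volume.restrict (Ioi R₀)) :=
      Integrable.const_mul (hg_int.mono_set (Ioi_subset_Ioi (le_max_right _ _))) C
    refine Integrable.mono' hgi hf_cont.aestronglyMeasurable ?_
    refine (ae_restrict_iff' measurableSet_Ioi).mpr (Eventually.of_forall fun σ hσ => ?_)
    have hσ' : Re ≤ σ := le_trans (le_max_left _ _) (le_of_lt hσ)
    calc ‖f σ‖ = |f σ| := Real.norm_eq_abs _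
      _ ≤ C * e σ * g (σ - T) := hflux σ
      _ ≤ C * 1 * g (σ - T) := by
          apply mul_le_mul_of_nonneg_right _ (hg_nn _)
          exact mul_le_mul_of_nonneg_left (hRe σ hσ') hC
      _ = C * g (σ - T) := by ring
  have hfi_s : ∀ s ≥ R₀, IntegrableOn f (Ioi s) := fun s hs => hfi.mono_set (Ioi_subset_Ioi hs)
  -- (3) the improper-integral identity
  set J : ℝ → ℝ := fun s => ∫ x in Ioi s, f x with hJ
  have ident : ∀ s ≥ R₀, e s = 2 * (c₂ * J s - c₁ * J (s + T)) := by
    intro s hs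
    have ftc : ∀ S, e S - e s =
        2 * (c₁ * (∫ x in (s + T)..(S + T), f x) - c₂ * ∫ x in s..S, f x) := by
      intro S
      have hd : ∀ x ∈ uIcc s S, HasDerivAt e (2 * (c₁ * f (x + T) - c₂ * f x)) x :=
        fun x _ => hderiv x
      have hsh : Continuous fun x => f (x + T) := hf_cont.comp (continuous_id.add continuous_const)
      have hcont' : Continuous fun x => 2 * (c₁ * f (x + T) - c₂ * f x) := by fun_prop
      have h1 := integral_eq_sub_of_hasDerivAt hd (hcont'.intervalIntegrable s S)
      have h2 : (∫ x in s..S, 2 * (c₁ * f (x + T) - c₂ * f x)) =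
          2 * (c₁ * (∫ x in s..S, f (x + T)) - c₂ * ∫ x in s..S, f x) := by
        rw [intervalIntegral.integral_const_mul, intervalIntegral.integral_sub,
          intervalIntegral.integral_const_mul, intervalIntegral.integral_const_mul]
        · exact (hsh.intervalIntegrable s S).const_mul c₁
        · exact (hf_cont.intervalIntegrable s S).const_mul c₂
      have h3 : (∫ x in s..S, f (x + T)) = ∫ x in s + T..S + T, f x :=
        intervalIntegral.integral_comp_add_right f T
      rw [← h1, h2, h3]
    have lim0 : Tendsto (fun S => ∫ x in s..S, f x) atTop (𝓝 (J s)) :=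
      intervalIntegral_tendsto_integral_Ioi s (hfi_s s hs) tendsto_id
    have lim1 : Tendsto (fun S => ∫ x in (s + T)..(S + T), f x) atTop (𝓝 (J (s + T))) :=
      intervalIntegral_tendsto_integral_Ioi (s + T) (hfi_s (s + T) (by linarith))
        (tendsto_atTop_add_const_right atTop T tendsto_id)
    have h1 : Tendsto (fun S => e S -
        2 * (c₁ * (∫ x in (s + T)..(S + T), f x) - c₂ * ∫ x in s..S, f x)) atTop
        (𝓝 (0 - 2 * (c₁ * J (s + T) - c₂ * J s))) :=
      he_lim.sub (((lim1.const_mul c₁).sub (lim0.const_mul c₂)).const_mul 2)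
    have h2 : (fun S => e S -
        2 * (c₁ * (∫ x in (s + T)..(S + T), f x) - c₂ * ∫ x in s..S, f x)) = fun _ => e s := by
      funext S; have := ftc S; linarith
    rw [h2] at h1
    have := tendsto_nhds_unique tendsto_const_nhds h1
    linarith
  -- (4) tail bound: `|J s| ≤ C M ∫_{(s,∞)} g(·−T)` whenever `e ≤ M` on `[s, ∞)`
  have tail : ∀ s M, R₀ ≤ s → 0 ≤ M → (∀ x ≥ s, e x ≤ M) →
      |J s| ≤ C * M * ∫ x in Ioi s, g (x - T) := by
    intro s M hs hMnn hM
    have hgi' : IntegrableOn (fun σ => g (σ - T)) (Ioi s) :=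
      hg_int.mono_set (Ioi_subset_Ioi (le_trans (le_max_right _ _) hs))
    have hgi'' : Integrable (fun σ => C * M * g (σ - T)) (volume.restrict (Ioi s)) :=
      Integrable.const_mul hgi' (C * M)
    have hbound : ∀ᵐ x ∂(volume.restrict (Ioi s)), ‖f x‖ ≤ C * M * g (x - T) := by
      refine (ae_restrict_iff' measurableSet_Ioi).mpr (Eventually.of_forall fun x hx => ?_)
      calc ‖f x‖ = |f x| := Real.norm_eq_abs _
        _ ≤ C * e x * g (x - T) := hflux x
        _ ≤ C * M * g (x - T) := by
            apply mul_le_mul_of_nonneg_right _ (hg_nn _)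
            exact mul_le_mul_of_nonneg_left (hM x (le_of_lt hx)) hC
    have h := norm_integral_le_of_norm_le hgi'' hbound
    rw [MeasureTheory.integral_const_mul] at h
    simpa only [hJ, Real.norm_eq_abs] using h
  -- (5) the tail of `g(·−T)` is eventually small
  set δ : ℝ := 1 / (4 * C * (|c₁| + |c₂|) + 4) with hδ
  have hδ_pos : 0 < δ := by rw [hδ]; positivity
  have hδ_small : 2 * C * (|c₁| + |c₂|) * δ ≤ 1 / 2 := by
    rw [hδ]
    have h4 : 0 < 4 * C * (|c₁| + |c₂|) + 4 := by positivity
    rw [show 2 * C * (|c₁| + |c₂|) * (1 / (4 * C * (|c₁| + |c₂|) + 4))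
        = (2 * C * (|c₁| + |c₂|)) / (4 * C * (|c₁| + |c₂|) + 4) by field_simp]
    rw [div_le_iff₀ h4]
    nlinarith [abs_nonneg c₁, abs_nonneg c₂]
  have hτ : Tendsto (fun s => ∫ x in Ioi s, g (x - T)) atTop (𝓝 0) :=
    tendsto_integral_Ioi_zero tendsto_id
  obtain ⟨S₁, hS₁⟩ := (Metric.tendsto_atTop.mp hτ) δ hδ_pos
  set s₁ := max S₁ R₀ with hs₁
  have hsmall : ∀ s ≥ s₁, ∫ x in Ioi s, g (x - T) ≤ δ := by
    intro s hs
    have := hS₁ s (le_trans (le_max_left _ _) hs)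
    rw [dist_zero_right, Real.norm_eq_abs] at this
    exact le_trans (le_abs_self _) (le_of_lt this)
  have hs₁R₀ : R₀ ≤ s₁ := le_max_right _ _
  -- (6) contradiction at a maximiser
  refine ⟨s₁, fun s hs => ?_⟩
  by_contra hne
  have hpos : 0 < e s := lt_of_le_of_ne (he_nn s) (Ne.symm hne)
  obtain ⟨R, hR⟩ : ∃ R, ∀ x ≥ R, e x ≤ e s / 2 := by
    obtain ⟨N, hN⟩ := (Metric.tendsto_atTop.mp he_lim) (e s / 2) (by linarith)
    refine ⟨N, fun x hx => ?_⟩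
    have := hN x hx
    rw [dist_zero_right, Real.norm_eq_abs, abs_of_nonneg (he_nn x)] at this
    exact le_of_lt this
  obtain ⟨σ₀, hσ₀mem, hσ₀max⟩ := (isCompact_Icc (a := s₁) (b := max s R)).exists_isMaxOn
    (nonempty_Icc.mpr (le_trans hs (le_max_left _ _))) he_cont.continuousOn
  have hsM : e s ≤ e σ₀ := hσ₀max ⟨hs, le_max_left _ _⟩
  have hM₀pos : 0 < e σ₀ := lt_of_lt_of_le hpos hsM
  have hbnd : ∀ x ≥ s₁, e x ≤ e σ₀ := by
    intro x hx
    by_cases h : x ≤ max s R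
    · exact hσ₀max ⟨hx, h⟩
    · have h' : max s R < x := lt_of_not_ge h
      have := hR x (le_trans (le_max_right _ _) (le_of_lt h'))
      linarith
  have hσ₀ : s₁ ≤ σ₀ := hσ₀mem.1
  have id0 := ident σ₀ (le_trans hs₁R₀ hσ₀)
  have t0 := tail σ₀ (e σ₀) (le_trans hs₁R₀ hσ₀) hM₀pos.le (fun x hx => hbnd x (le_trans hσ₀ hx))
  have t1 := tail (σ₀ + T) (e σ₀) (by linarith) hM₀pos.le (fun x hx => hbnd x (by linarith))
  have hτ0 := hsmall σ₀ hσ₀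
  have hτ1 := hsmall (σ₀ + T) (by linarith)
  have i0 : 0 ≤ ∫ x in Ioi σ₀, g (x - T) :=
    setIntegral_nonneg measurableSet_Ioi fun x _ => hg_nn _
  have i1 : 0 ≤ ∫ x in Ioi (σ₀ + T), g (x - T) :=
    setIntegral_nonneg measurableSet_Ioi fun x _ => hg_nn _
  have a0 : c₂ * J σ₀ ≤ |c₂| * |J σ₀| := by rw [← abs_mul]; exact le_abs_self _
  have a1 : -(c₁ * J (σ₀ + T)) ≤ |c₁| * |J (σ₀ + T)| := by rw [← abs_mul]; exact neg_le_abs _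
  have b0 : |J σ₀| ≤ C * e σ₀ * δ :=
    le_trans t0 (mul_le_mul_of_nonneg_left hτ0 (by positivity))
  have b1 : |J (σ₀ + T)| ≤ C * e σ₀ * δ :=
    le_trans t1 (mul_le_mul_of_nonneg_left hτ1 (by positivity))
  have : e σ₀ ≤ (2 * C * (|c₁| + |c₂|) * δ) * e σ₀ := by
    nlinarith [abs_nonneg c₁, abs_nonneg c₂, mul_le_mul_of_nonneg_left b0 (abs_nonneg c₂),
      mul_le_mul_of_nonneg_left b1 (abs_nonneg c₁)]
  nlinarith


/-! ## Part 2.  The abstract S-topology profile system (theory-2 g5) -/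

section AbstractS

variable {V : Type*} [NormedAddCommGroup V]
variable {ρ : Type*} [Fintype ρ]

variable [InnerProductSpace ℝ V]

/-- `A 0 = 0` (from the quadratic bound).
[cite: Tao2016AveragedNS, §4 (4.2)–(4.3), Lemma 4.1 (4.8)–(4.10); cell theorems A/B/B′] -/
theorem STable.A_zero {Q A : V → V} {B : V → V → V} {CA : ℝ} (hS : STable Q A B CA) :
    A 0 = 0 := by
  have h : ‖A 0‖ ≤ 0 := by simpa using hS.normA 0
  exact norm_le_zero_iff.mp h

/-- **Flux bound** (first use of the topology `S`): `|F σ| ≤ C_A · E σ · G (σ − T)`.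
[cite: Tao2016AveragedNS, §4 (4.2)–(4.3), Lemma 4.1 (4.8)–(4.10); cell theorems A/B/B′] -/
theorem abs_sFlux_le {Q A : V → V} {B : V → V → V} {CA : ℝ} (hS : STable Q A B CA)
    (π : Equiv.Perm ρ) (T : ℝ) (Φ : ρ → ℝ → V) (σ : ℝ) :
    |sFlux π A T Φ σ| ≤ CA * sEnergy Φ σ * sMass Φ (σ - T) := by
  unfold sFlux sEnergy
  calc |∑ r, ⟪Φ (π r) (σ - T), A (Φ r σ)⟫|
      ≤ ∑ r, |⟪Φ (π r) (σ - T), A (Φ r σ)⟫| := Finset.abs_sum_le_sum_abs _ _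
    _ ≤ ∑ r, sMass Φ (σ - T) * (CA * ‖Φ r σ‖ ^ 2) := by
        apply Finset.sum_le_sum
        intro r _
        calc |⟪Φ (π r) (σ - T), A (Φ r σ)⟫| ≤ ‖Φ (π r) (σ - T)‖ * ‖A (Φ r σ)‖ :=
              abs_real_inner_le_norm _ _
          _ ≤ sMass Φ (σ - T) * (CA * ‖Φ r σ‖ ^ 2) :=
              mul_le_mul (norm_le_sMass Φ (σ - T) (π r)) (hS.normA _) (norm_nonneg _)
                (sMass_nonneg Φ _)
    _ = CA * (∑ r, ‖Φ r σ‖ ^ 2) * sMass Φ (σ - T) := by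
        rw [← Finset.mul_sum, ← Finset.mul_sum]
        ring

/-- **Energy identity** along the profile family: `E' = −2d E + 2c₁ F(·+T) − 2c₂ F`.
Uses `⟪x, Q x⟫ = 0`, the cancellation identity and the reindexing `r ↦ π r`.
[cite: Tao2016AveragedNS, §4 (4.2)–(4.3), Lemma 4.1 (4.8)–(4.10); cell theorems A/B/B′] -/
theorem hasDerivAt_sEnergy {π : Equiv.Perm ρ} {Q A : V → V} {B : V → V → V} {CA d c₁ c₂ T : ℝ}
    (hS : STable Q A B CA) {Φ : ρ → ℝ → V} (hΦ : IsSWave π Q A B d c₁ c₂ T Φ) (x : ℝ) :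
    HasDerivAt (sEnergy Φ)
      (-2 * d * sEnergy Φ x + 2 * c₁ * sFlux π A T Φ (x + T) - 2 * c₂ * sFlux π A T Φ x) x := by
  have h : HasDerivAt (sEnergy Φ)
      (∑ r, 2 * ⟪Φ r x, (-(d • Φ r x) + Q (Φ r x) + c₁ • A (Φ (π.symm r) (x + T))
        + c₂ • B (Φ (π r) (x - T)) (Φ r x))⟫) x :=
    HasDerivAt.fun_sum fun r _ => (hΦ r x).norm_sq
  refine h.congr_deriv ?_
  have e1 : ∀ r, 2 * ⟪Φ r x, (-(d • Φ r x) + Q (Φ r x) + c₁ • A (Φ (π.symm r) (x + T))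
        + c₂ • B (Φ (π r) (x - T)) (Φ r x))⟫
      = -2 * d * ‖Φ r x‖ ^ 2 + 2 * c₁ * ⟪Φ r x, A (Φ (π.symm r) (x + T))⟫
        - 2 * c₂ * ⟪Φ (π r) (x - T), A (Φ r x)⟫ := by
    intro r
    rw [inner_add_right, inner_add_right, inner_add_right, inner_neg_right, real_inner_smul_right,
      real_inner_smul_right, real_inner_smul_right, real_inner_self_eq_norm_sq, hS.intra]
    have hc := hS.cancel (Φ r x) (Φ (π r) (x - T))
    linear_combination 2 * c₂ * hc
  have e2 : ∑ r, ⟪Φ r x, A (Φ (π.symm r) (x + T))⟫ = sFlux π A T Φ (x + T) := by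
    unfold sFlux
    rw [← Equiv.sum_comp π (fun r => ⟪Φ r x, A (Φ (π.symm r) (x + T))⟫)]
    simp only [Equiv.symm_apply_apply, add_sub_cancel_right]
  simp_rw [e1]
  rw [Finset.sum_sub_distrib, Finset.sum_add_distrib, ← Finset.mul_sum, ← Finset.mul_sum,
    ← Finset.mul_sum, e2]
  rfl

/-- Backward Grönwall to zero: `u ≥ 0`, `u t₀ = 0` and `u' + L u ≥ 0` on `(t₀ − T, t₀)` give
`u = 0` on `[t₀ − T, t₀]` (the function `y ↦ u (t₀ − y) e^{−Ly}` is antitone on `[0, T]`).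
[cite: Tao2016AveragedNS, §4 (4.2)–(4.3), Lemma 4.1 (4.8)–(4.10); cell theorems A/B/B′] -/
theorem eq_zero_Icc_of_deriv_ge {u u' : ℝ → ℝ} {t₀ T L : ℝ} (hT : 0 < T)
    (hu : ∀ x, HasDerivAt u (u' x) x) (hu_nn : ∀ x, 0 ≤ u x) (h0 : u t₀ = 0)
    (key : ∀ x, t₀ - T < x → x < t₀ → 0 ≤ u' x + L * u x) :
    ∀ x, t₀ - T ≤ x → x ≤ t₀ → u x = 0 := by
  have hu_cont : Continuous u := continuous_iff_continuousAt.mpr fun x => (hu x).continuousAt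
  set w : ℝ → ℝ := fun y => u (t₀ - y) * Real.exp (-(L * y)) with hw
  have hw_deriv : ∀ y, HasDerivAt w
      (-(u' (t₀ - y)) * Real.exp (-(L * y))
        + u (t₀ - y) * (Real.exp (-(L * y)) * (-(L * 1)))) y := by
    intro y
    have h1 : HasDerivAt (fun y => u (t₀ - y)) (-(u' (t₀ - y))) y :=
      (hu (t₀ - y)).comp_const_sub t₀ y
    have h2 : HasDerivAt (fun y => Real.exp (-(L * y))) (Real.exp (-(L * y)) * (-(L * 1))) y :=
      (((hasDerivAt_id y).const_mul L).neg).exp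
    exact h1.mul h2
  have hw_cont : Continuous w := by
    have : Continuous fun y => u (t₀ - y) := hu_cont.comp (continuous_const.sub continuous_id)
    exact this.mul (by fun_prop)
  have hw_anti : AntitoneOn w (Icc 0 T) := by
    apply antitoneOn_of_deriv_nonpos (convex_Icc 0 T) hw_cont.continuousOn
    · intro y _; exact (hw_deriv y).differentiableAt.differentiableWithinAt
    · intro y hy
      rw [interior_Icc] at hy
      rw [(hw_deriv y).deriv]
      have hk := key (t₀ - y) (by linarith [hy.2]) (by linarith [hy.1])
      have hexp : 0 < Real.exp (-(L * y)) := Real.exp_pos _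
      have : -(u' (t₀ - y)) * Real.exp (-(L * y))
          + u (t₀ - y) * (Real.exp (-(L * y)) * (-(L * 1)))
          = -(Real.exp (-(L * y)) * (u' (t₀ - y) + L * u (t₀ - y))) := by ring
      rw [this, neg_nonpos]
      exact mul_nonneg hexp.le hk
  intro x hx1 hx2
  have hy : t₀ - x ∈ Icc 0 T := ⟨by linarith, by linarith⟩
  have h0' : (0:ℝ) ∈ Icc 0 T := ⟨le_rfl, hT.le⟩
  have hwle : w (t₀ - x) ≤ w 0 := hw_anti h0' hy (by linarith)
  have hw0 : w 0 = 0 := by simp [hw, h0]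
  have hwx : w (t₀ - x) = u x * Real.exp (-(L * (t₀ - x))) := by simp only [hw, sub_sub_cancel]
  rw [hw0, hwx] at hwle
  have hexp : 0 < Real.exp (-(L * (t₀ - x))) := Real.exp_pos _
  have hux : u x ≤ 0 := by
    by_contra hcon
    have hcon' : 0 < u x := lt_of_not_ge hcon
    linarith [mul_pos hcon' hexp]
  exact le_antisymm hux (hu_nn x)

omit [Fintype ρ] in
/-- Continuity facts used repeatedly.
[cite: Tao2016AveragedNS, §4 (4.2)–(4.3), Lemma 4.1 (4.8)–(4.10); cell theorems A/B/B′] -/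
theorem IsSWave.continuous {π : Equiv.Perm ρ} {Q A : V → V} {B : V → V → V}
    {d c₁ c₂ T : ℝ} {Φ : ρ → ℝ → V} (hΦ : IsSWave π Q A B d c₁ c₂ T Φ) (r : ρ) :
    Continuous (Φ r) :=
  continuous_iff_continuousAt.mpr fun x => (hΦ r x).continuousAt

/-- [cite: Tao2016AveragedNS, §4 (4.2)–(4.3), Lemma 4.1 (4.8)–(4.10); cell theorems A/B/B′] -/
theorem IsSWave.continuous_sEnergy {π : Equiv.Perm ρ} {Q A : V → V} {B : V → V → V}
    {d c₁ c₂ T : ℝ} {Φ : ρ → ℝ → V} (hΦ : IsSWave π Q A B d c₁ c₂ T Φ) :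
    Continuous (sEnergy Φ) := by
  unfold sEnergy; exact continuous_finsetSum _ fun r _ => (hΦ.continuous r).norm.pow 2

/-- [cite: Tao2016AveragedNS, §4 (4.2)–(4.3), Lemma 4.1 (4.8)–(4.10); cell theorems A/B/B′] -/
theorem IsSWave.continuous_sMass {π : Equiv.Perm ρ} {Q A : V → V} {B : V → V → V}
    {d c₁ c₂ T : ℝ} {Φ : ρ → ℝ → V} (hΦ : IsSWave π Q A B d c₁ c₂ T Φ) :
    Continuous (sMass Φ) := by
  unfold sMass; exact continuous_finsetSum _ fun r _ => (hΦ.continuous r).norm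

/-- [cite: Tao2016AveragedNS, §4 (4.2)–(4.3), Lemma 4.1 (4.8)–(4.10); cell theorems A/B/B′] -/
theorem IsSWave.continuous_sFlux {π : Equiv.Perm ρ} {Q A : V → V} {B : V → V → V}
    {CA d c₁ c₂ T : ℝ} (hS : STable Q A B CA) {Φ : ρ → ℝ → V}
    (hΦ : IsSWave π Q A B d c₁ c₂ T Φ) : Continuous (sFlux π A T Φ) := by
  unfold sFlux
  refine continuous_finsetSum _ fun r _ => ?_
  exact ((hΦ.continuous (π r)).comp (continuous_id.sub continuous_const)).inner
    (hS.contA.comp (hΦ.continuous r))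

/-- **Backward step** (second use of `S`: no monomial feeds a shell from the shell above alone).
If every profile vanishes on `[t₀, ∞)` then every profile vanishes on `[t₀ − T, ∞)`.
[cite: Tao2016AveragedNS, §4 (4.2)–(4.3), Lemma 4.1 (4.8)–(4.10); cell theorems A/B/B′] -/
theorem IsSWave.backward_step {π : Equiv.Perm ρ} {Q A : V → V} {B : V → V → V}
    {CA d c₁ c₂ T : ℝ} (hS : STable Q A B CA) (hT : 0 < T) {Φ : ρ → ℝ → V}
    (hΦ : IsSWave π Q A B d c₁ c₂ T Φ) {t₀ : ℝ} (hzero : ∀ r, ∀ x ≥ t₀, Φ r x = 0) :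
    ∀ r, ∀ x ≥ t₀ - T, Φ r x = 0 := by
  obtain ⟨Y, hY⟩ : ∃ Y, ∀ y ∈ Icc (t₀ - 2 * T) (t₀ - T), sMass Φ y ≤ Y := by
    obtain ⟨y₀, _, hy₀⟩ := (isCompact_Icc (a := t₀ - 2 * T) (b := t₀ - T)).exists_isMaxOn
      (nonempty_Icc.mpr (by linarith)) hΦ.continuous_sMass.continuousOn
    exact ⟨sMass Φ y₀, fun y hy => hy₀ hy⟩
  have hCA := hS.CA_nonneg
  set L : ℝ := 2 * |d| + 2 * |c₂| * CA * Y with hL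
  have key : ∀ x, t₀ - T < x → x < t₀ →
      0 ≤ (-2 * d * sEnergy Φ x + 2 * c₁ * sFlux π A T Φ (x + T) - 2 * c₂ * sFlux π A T Φ x)
        + L * sEnergy Φ x := by
    intro x hx1 hx2
    have hF1 : sFlux π A T Φ (x + T) = 0 := by
      unfold sFlux
      apply Finset.sum_eq_zero
      intro r _
      rw [hzero r (x + T) (by linarith), hS.A_zero, inner_zero_right]
    have hE := sEnergy_nonneg Φ x
    have hF0 : |sFlux π A T Φ x| ≤ CA * sEnergy Φ x * Y :=
      le_trans (abs_sFlux_le hS π T Φ x)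
        (mul_le_mul_of_nonneg_left (hY (x - T) ⟨by linarith, by linarith⟩)
          (mul_nonneg hCA hE))
    have h1 : d * sEnergy Φ x ≤ |d| * sEnergy Φ x :=
      mul_le_mul_of_nonneg_right (le_abs_self d) hE
    have h2 : c₂ * sFlux π A T Φ x ≤ |c₂| * (CA * sEnergy Φ x * Y) := by
      have : c₂ * sFlux π A T Φ x ≤ |c₂| * |sFlux π A T Φ x| := by
        rw [← abs_mul]; exact le_abs_self _
      exact le_trans this (mul_le_mul_of_nonneg_left hF0 (abs_nonneg _))
    rw [hF1, hL]
    linarith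
  have hz := eq_zero_Icc_of_deriv_ge hT (fun x => hasDerivAt_sEnergy hS hΦ x)
    (sEnergy_nonneg Φ) (sEnergy_eq_zero fun r => hzero r t₀ le_rfl) key
  intro r x hx
  by_cases hxt : t₀ ≤ x
  · exact hzero r x hxt
  · exact eq_zero_of_sEnergy_eq_zero (hz x hx (le_of_lt (lt_of_not_ge hxt))) r

/-- From "eventually zero" to "zero": induction over periods with the backward step.
[cite: Tao2016AveragedNS, §4 (4.2)–(4.3), Lemma 4.1 (4.8)–(4.10); cell theorems A/B/B′] -/
theorem IsSWave.eq_zero_of_eventually_zero {π : Equiv.Perm ρ} {Q A : V → V} {B : V → V → V}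
    {CA d c₁ c₂ T : ℝ} (hS : STable Q A B CA) (hT : 0 < T) {Φ : ρ → ℝ → V}
    (hΦ : IsSWave π Q A B d c₁ c₂ T Φ) {s₀ : ℝ} (hzero : ∀ r, ∀ x ≥ s₀, Φ r x = 0) :
    ∀ r x, Φ r x = 0 := by
  have step : ∀ j : ℕ, ∀ r, ∀ x ≥ s₀ - j * T, Φ r x = 0 := by
    intro j
    induction j with
    | zero => simpa using hzero
    | succ j ih =>
      have hb := hΦ.backward_step hS hT ih
      intro r x hx
      exact hb r x (by push_cast at hx ⊢; linarith)
  intro r x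
  obtain ⟨j, hj⟩ := exists_nat_gt ((s₀ - x) / T)
  refine step j r x ?_
  have h' : s₀ - x < j * T := (div_lt_iff₀ hT).mp hj
  show s₀ - ↑j * T ≤ x
  linarith

/-- **THEOREM A (general table, period-q; `λ = 1`).**  A profile family of the uniform lattice
of ANY S-topology table (`d = 0`, `c₁ = c₂ = 1`) with trailing decay `Φ_r → 0` at `+∞`
vanishes identically: no travelling and no period-`q` cascade wave empties the shells it
passes.  (Model statement about lattice ODEs; nothing here is a claim about Navier–Stokes.)
[cite: Tao2016AveragedNS, §4 (4.2)–(4.3), Lemma 4.1 (4.8)–(4.10); cell theorems A/B/B′] -/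
theorem IsSWave.eq_zero_of_trailing_decay {π : Equiv.Perm ρ} {Q A : V → V} {B : V → V → V}
    {CA T : ℝ} (hS : STable Q A B CA) (hT : 0 < T) {Φ : ρ → ℝ → V}
    (hΦ : IsSWave π Q A B 0 1 1 T Φ) (decay : ∀ r, Tendsto (Φ r) atTop (𝓝 0)) :
    ∀ r x, Φ r x = 0 := by
  have hderiv : ∀ x, HasDerivAt (sEnergy Φ)
      (2 * (sFlux π A T Φ (x + T) - sFlux π A T Φ x)) x := by
    intro x
    refine (hasDerivAt_sEnergy hS hΦ x).congr_deriv ?_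
    ring
  have hflux : ∀ σ, |sFlux π A T Φ σ| ≤ CA * sEnergy Φ σ * sMass Φ (σ - T) :=
    fun σ => abs_sFlux_le hS π T Φ σ
  have he_lim : Tendsto (sEnergy Φ) atTop (𝓝 0) := by
    have h : Tendsto (fun x => ∑ r, ‖Φ r x‖ ^ 2) atTop (𝓝 (∑ _r : ρ, (0:ℝ))) :=
      tendsto_finsetSum _ fun r _ => by simpa using ((decay r).norm).pow 2
    rw [Finset.sum_const_zero] at h
    exact h
  have hg_lim : Tendsto (sMass Φ) atTop (𝓝 0) := by
    have h : Tendsto (fun x => ∑ r, ‖Φ r x‖) atTop (𝓝 (∑ _r : ρ, (0:ℝ))) :=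
      tendsto_finsetSum _ fun r _ => by simpa using (decay r).norm
    rw [Finset.sum_const_zero] at h
    exact h
  have hg_lim' : Tendsto (fun σ => sMass Φ (σ - T)) atTop (𝓝 0) :=
    hg_lim.comp (tendsto_atTop_add_const_right atTop (-T) tendsto_id)
  have hf_lim : Tendsto (sFlux π A T Φ) atTop (𝓝 0) := by
    have hb : Tendsto (fun σ => CA * sEnergy Φ σ * sMass Φ (σ - T)) atTop (𝓝 0) := by
      simpa using (he_lim.const_mul CA).mul hg_lim'
    exact squeeze_zero_norm (fun σ => by rw [Real.norm_eq_abs]; exact hflux σ) hb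
  obtain ⟨s₀, hs₀⟩ := eventually_zero_of_wave_identity hT hS.CA_nonneg hΦ.continuous_sEnergy
    (hΦ.continuous_sFlux hS) (sEnergy_nonneg Φ) (sMass_nonneg Φ) hderiv hflux he_lim hf_lim
    hg_lim
  exact hΦ.eq_zero_of_eventually_zero hS hT fun r x hx => eq_zero_of_sEnergy_eq_zero (hs₀ x hx) r

/-- **THEOREM B (general table, period-q; renormalised self-similar variables, any `λ`).**
A profile family of the damped lopsided system (`d > 0`, ANY real `c₁, c₂`) with ZERO RESIDUE
— `e^{d x} ‖Φ_r x‖ → 0` at `+∞` for every `r` — vanishes identically: a discretely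
self-similar cascade on an `S`-table cannot empty its shells at the blow-up time.  (Model
statement about lattice ODEs; nothing here is a claim about Navier–Stokes.)
[cite: Tao2016AveragedNS, §4 (4.2)–(4.3), Lemma 4.1 (4.8)–(4.10); cell theorems A/B/B′] -/
theorem IsSWave.eq_zero_of_zero_residue {π : Equiv.Perm ρ} {Q A : V → V} {B : V → V → V}
    {CA d c₁ c₂ T : ℝ} (hS : STable Q A B CA) (hT : 0 < T) (hd : 0 < d) {Φ : ρ → ℝ → V}
    (hΦ : IsSWave π Q A B d c₁ c₂ T Φ)
    (residue : ∀ r, Tendsto (fun x => Real.exp (d * x) * ‖Φ r x‖) atTop (𝓝 0)) :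
    ∀ r x, Φ r x = 0 := by
  have ce := hΦ.continuous_sEnergy
  have cF := hΦ.continuous_sFlux hS
  have hCA := hS.CA_nonneg
  -- the weighted identity: (e^{2dx} E)' = 2 (c₁ e^{-2dT} f̃ (x+T) - c₂ f̃ x), f̃ := e^{2dx} F
  have hderiv : ∀ x, HasDerivAt (fun x => Real.exp (2 * d * x) * sEnergy Φ x)
      (2 * (c₁ * Real.exp (-(2 * d * T))
        * (Real.exp (2 * d * (x + T)) * sFlux π A T Φ (x + T))
        - c₂ * (Real.exp (2 * d * x) * sFlux π A T Φ x))) x := by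
    intro x
    have h1 : HasDerivAt (fun x => Real.exp (2 * d * x)) (Real.exp (2 * d * x) * (2 * d * 1)) x :=
      ((hasDerivAt_id x).const_mul (2 * d)).exp
    refine (h1.mul (hasDerivAt_sEnergy hS hΦ x)).congr_deriv ?_
    have ex1 : Real.exp (2 * d * (x + T)) = Real.exp (2 * d * x) * Real.exp (2 * d * T) := by
      rw [← Real.exp_add]; congr 1; ring
    have ex2 : Real.exp (-(2 * d * T)) * Real.exp (2 * d * T) = 1 := by
      rw [Real.exp_neg, inv_mul_cancel₀ (Real.exp_pos _).ne']
    rw [ex1]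
    linear_combination (-(2 * c₁ * Real.exp (2 * d * x) * sFlux π A T Φ (x + T))) * ex2
  have hflux : ∀ σ, |Real.exp (2 * d * σ) * sFlux π A T Φ σ|
      ≤ CA * (Real.exp (2 * d * σ) * sEnergy Φ σ) * sMass Φ (σ - T) := by
    intro σ
    rw [abs_mul, abs_of_pos (Real.exp_pos _)]
    calc Real.exp (2 * d * σ) * |sFlux π A T Φ σ|
        ≤ Real.exp (2 * d * σ) * (CA * sEnergy Φ σ * sMass Φ (σ - T)) :=
          mul_le_mul_of_nonneg_left (abs_sFlux_le hS π T Φ σ) (Real.exp_pos _).le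
      _ = _ := by ring
  -- ẽ → 0 from the zero-residue hypothesis
  have he_lim : Tendsto (fun x => Real.exp (2 * d * x) * sEnergy Φ x) atTop (𝓝 0) := by
    have h : Tendsto (fun x => ∑ r, (Real.exp (d * x) * ‖Φ r x‖) ^ 2) atTop
        (𝓝 (∑ _r : ρ, (0:ℝ))) :=
      tendsto_finsetSum _ fun r _ => by simpa using (residue r).pow 2
    rw [Finset.sum_const_zero] at h
    refine (tendsto_congr fun x => ?_).mp h
    simp only [sEnergy, Finset.mul_sum]
    refine Finset.sum_congr rfl fun r _ => ?_
    have h2 : Real.exp (2 * d * x) = Real.exp (d * x) ^ 2 := by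
      rw [sq, ← Real.exp_add]; congr 1; ring
    rw [h2]; ring
  -- the mass tail is integrable: Σ_r e^{dx} ‖Φ_r x‖ ≤ 1 for x ≥ R
  have hsum : Tendsto (fun x => ∑ r, Real.exp (d * x) * ‖Φ r x‖) atTop (𝓝 0) := by
    have h : Tendsto (fun x => ∑ r, Real.exp (d * x) * ‖Φ r x‖) atTop (𝓝 (∑ _r : ρ, (0:ℝ))) :=
      tendsto_finsetSum _ fun r _ => residue r
    simpa using h
  obtain ⟨R, hR⟩ : ∃ R, ∀ x ≥ R, ∑ r, Real.exp (d * x) * ‖Φ r x‖ ≤ 1 := by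
    obtain ⟨N, hN⟩ := (Metric.tendsto_atTop.mp hsum) 1 one_pos
    refine ⟨N, fun x hx => ?_⟩
    have h := hN x hx
    rw [dist_zero_right, Real.norm_eq_abs] at h
    exact le_trans (le_abs_self _) (le_of_lt h)
  have hmass : ∀ x ≥ R, sMass Φ x ≤ Real.exp (-(d * x)) := by
    intro x hx
    have h1 : Real.exp (d * x) * sMass Φ x ≤ 1 := by
      simpa [sMass, Finset.mul_sum] using hR x hx
    calc sMass Φ x = Real.exp (-(d * x)) * (Real.exp (d * x) * sMass Φ x) := by
          rw [← mul_assoc, ← Real.exp_add]; simp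
      _ ≤ Real.exp (-(d * x)) * 1 := mul_le_mul_of_nonneg_left h1 (Real.exp_pos _).le
      _ = Real.exp (-(d * x)) := mul_one _
  have hg_int : IntegrableOn (fun σ => sMass Φ (σ - T)) (Ioi (R + T)) := by
    have hdom : Integrable (fun σ => Real.exp (d * T) * Real.exp (-d * σ))
        (volume.restrict (Ioi (R + T))) :=
      Integrable.const_mul (exp_neg_integrableOn_Ioi (R + T) hd) _
    refine Integrable.mono' hdom
      ((hΦ.continuous_sMass.comp (continuous_id.sub continuous_const)).aestronglyMeasurable) ?_
    refine (ae_restrict_iff' measurableSet_Ioi).mpr (Eventually.of_forall fun σ hσ => ?_)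
    have hσ' : R ≤ σ - T := by simp only [mem_Ioi] at hσ; linarith
    calc ‖sMass Φ (σ - T)‖ = sMass Φ (σ - T) := by
            rw [Real.norm_eq_abs, abs_of_nonneg (sMass_nonneg Φ _)]
      _ ≤ Real.exp (-(d * (σ - T))) := hmass (σ - T) hσ'
      _ = Real.exp (d * T) * Real.exp (-d * σ) := by
            rw [← Real.exp_add]; congr 1; ring
  obtain ⟨s₀, hs₀⟩ := eventually_zero_of_weighted_wave_identity
    (e := fun x => Real.exp (2 * d * x) * sEnergy Φ x)
    (f := fun x => Real.exp (2 * d * x) * sFlux π A T Φ x) (g := sMass Φ)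
    hT hCA (by fun_prop) (by fun_prop)
    (fun x => mul_nonneg (Real.exp_pos _).le (sEnergy_nonneg Φ x)) (sMass_nonneg Φ)
    hderiv hflux he_lim hg_int
  refine hΦ.eq_zero_of_eventually_zero hS hT (s₀ := s₀) fun r x hx => ?_
  have h0 : Real.exp (2 * d * x) * sEnergy Φ x = 0 := hs₀ x hx
  have hE : sEnergy Φ x = 0 := by
    rcases mul_eq_zero.mp h0 with h | h
    · exact absurd h (Real.exp_pos _).ne'
    · exact h
  exact eq_zero_of_sEnergy_eq_zero hE r

/-! ### Corollaries: a single travelling wave (`ρ = Unit`, `π = 1`) -/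

/-- A single travelling wave (`IsTW`, period `λ = 1`) is an S-wave indexed by `Unit` with the
trivial permutation `π = 1` (the dictionary used by the corollaries below).
[cite: Tao2016AveragedNS, §4 Lemma 4.1 (4.8)–(4.10); cell theorems A/B (λ = 1 case)] -/
theorem IsTW.isSWave {Q A : V → V} {B : V → V → V} {d c₁ c₂ T : ℝ} {Φ : ℝ → V}
    (hΦ : IsTW Q A B d c₁ c₂ T Φ) :
    IsSWave (Equiv.refl Unit) Q A B d c₁ c₂ T (fun _ : Unit => Φ) :=
  fun _ x => hΦ x

/-- Theorem A for a single travelling wave on any S-table (`λ = 1`).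
[cite: Tao2016AveragedNS, §4 (4.2)–(4.3), Lemma 4.1 (4.8)–(4.10); cell theorems A/B/B′] -/
theorem IsTW.eq_zero_of_trailing_decay {Q A : V → V} {B : V → V → V} {CA T : ℝ}
    (hS : STable Q A B CA) (hT : 0 < T) {Φ : ℝ → V} (hΦ : IsTW Q A B 0 1 1 T Φ)
    (decay : Tendsto Φ atTop (𝓝 0)) : ∀ x, Φ x = 0 :=
  fun x => hΦ.isSWave.eq_zero_of_trailing_decay hS hT (fun _ => decay) () x

/-- Theorem B for a single discretely self-similar cascade on any S-table (any `λ`).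
[cite: Tao2016AveragedNS, §4 (4.2)–(4.3), Lemma 4.1 (4.8)–(4.10); cell theorems A/B/B′] -/
theorem IsTW.eq_zero_of_zero_residue {Q A : V → V} {B : V → V → V} {CA d c₁ c₂ T : ℝ}
    (hS : STable Q A B CA) (hT : 0 < T) (hd : 0 < d) {Φ : ℝ → V}
    (hΦ : IsTW Q A B d c₁ c₂ T Φ)
    (residue : Tendsto (fun x => Real.exp (d * x) * ‖Φ x‖) atTop (𝓝 0)) : ∀ x, Φ x = 0 :=
  fun x => hΦ.isSWave.eq_zero_of_zero_residue hS hT hd (fun _ => residue) () x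

/-! ## Part 4.  THEOREM B′ — the effective residue bound (theory-2 g5, second instalment)

Scalar core: a backward comparison lemma for the advanced-argument derivative bound
`|e'(x)| ≤ a(x) e(x+T) + b(x) e(x)` (window-by-window use of Mathlib's
`image_le_of_deriv_right_lt_deriv_boundary'`), and the abstract bound
`e x ≤ exp(2C(|c₁|+|c₂|)∫g) · lim e` for the weighted wave identity with integrable mass `g`.
Then THEOREM B′ for S-waves: if the mass `Σ_r ‖Φ_r‖` is integrable on `ℝ` and the weighted
energy `e^{2dx} Σ_r ‖Φ_r x‖²` has a limit `R²` at `+∞` (the residue level), then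
`e^{2dx} Σ_r ‖Φ_r x‖² ≤ exp(H) · R²` for EVERY `x`, with the ACTION
`H = 2 C_A (|c₁| e^{-2dT} + |c₂|) ∫ Σ_r ‖Φ_r‖`.  Reading (model lattices): a discretely
self-similar cascade on an S-table retains in every shell at least the fraction `e^{-H}` of that
shell's peak (weighted) energy; in particular `R² > 0` for a non-trivial wave (Theorem B with a
constant).  Any real `d, c₁, c₂`; no sign conditions. -/

/-- Backward comparison with an advanced argument, window by window.
If `|e'| ≤ a x * e (x+T) + b x * e x` with `a, b ≥ 0` continuous, `e ≥ 0` continuous,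
`e ≤ M` on `[y, ∞)`, then for every `η > 0` and `t ≥ 0`:
`e (y - t) ≤ (M + η) * exp (∫ σ in (y-t)..y, (a σ + b σ) + η * t)`.
[cite: Tao2016AveragedNS, §4 (4.2)–(4.3), Lemma 4.1 (4.8)–(4.10); cell theorems A/B/B′] -/
theorem backward_comparison {e e' a b : ℝ → ℝ} {T M y η : ℝ} (hT : 0 < T) (hη : 0 < η)
    (hM : 0 ≤ M) (he_cont : Continuous e) (ha_cont : Continuous a) (hb_cont : Continuous b)
    (ha_nn : ∀ x, 0 ≤ a x) (hb_nn : ∀ x, 0 ≤ b x)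
    (hderiv : ∀ x, HasDerivAt e (e' x) x)
    (hbound : ∀ x, |e' x| ≤ a x * e (x + T) + b x * e x)
    (htail : ∀ x, y ≤ x → e x ≤ M) :
    ∀ t, 0 ≤ t → e (y - t) ≤ (M + η) * Real.exp ((∫ σ in (y - t)..y, (a σ + b σ)) + η * t) := by
  -- notation
  set h : ℝ → ℝ := fun σ => a σ + b σ with hh
  have h_cont : Continuous h := ha_cont.add hb_cont
  have h_nn : ∀ σ, 0 ≤ h σ := fun σ => add_nonneg (ha_nn σ) (hb_nn σ)
  -- primitive from y
  set P : ℝ → ℝ := fun u => ∫ σ in y..u, h σ with hP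
  have hPderiv : ∀ u, HasDerivAt P (h u) u := fun u =>
    intervalIntegral.integral_hasDerivAt_right (h_cont.intervalIntegrable _ _)
      (h_cont.stronglyMeasurableAtFilter _ _) h_cont.continuousAt
  -- comparison function
  set Bf : ℝ → ℝ := fun t => (M + η) * Real.exp (-(P (y - t)) + η * t) with hBf
  have hBf_eq : ∀ t, (M + η) * Real.exp ((∫ σ in (y - t)..y, h σ) + η * t) = Bf t := by
    intro t
    simp only [hBf, hP, intervalIntegral.integral_symm y (y - t)]
  have hMη : 0 < M + η := by linarith
  have hBf_pos : ∀ t, 0 < Bf t := fun t => mul_pos hMη (Real.exp_pos _)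
  -- Bf is ≥ M for t ≥ 0 and monotone on t ≥ 0
  have hP_nonpos : ∀ t, 0 ≤ t → P (y - t) ≤ 0 := by
    intro t ht
    simp only [hP]
    rw [intervalIntegral.integral_symm, neg_nonpos]
    exact intervalIntegral.integral_nonneg (by linarith) fun σ _ => h_nn σ
  have hBf_ge : ∀ t, 0 ≤ t → M ≤ Bf t := by
    intro t ht
    have : (1:ℝ) ≤ Real.exp (-(P (y - t)) + η * t) := by
      rw [← Real.exp_zero]; exact Real.exp_le_exp.mpr (by nlinarith [hP_nonpos t ht, hη.le])
    calc M ≤ (M + η) * 1 := by linarith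
      _ ≤ (M + η) * Real.exp (-(P (y - t)) + η * t) :=
          mul_le_mul_of_nonneg_left this hMη.le
  have hBf_mono : ∀ s t, 0 ≤ s → s ≤ t → Bf s ≤ Bf t := by
    intro s t hs hst
    simp only [hBf]
    refine mul_le_mul_of_nonneg_left (Real.exp_le_exp.mpr ?_) hMη.le
    have hPst : P (y - t) ≤ P (y - s) := by
      simp only [hP]
      have := intervalIntegral.integral_interval_sub_left (f := h) (μ := volume)
        (a := y) (b := y - s) (c := y - t)
        (h_cont.intervalIntegrable _ _) (h_cont.intervalIntegrable _ _)
      -- ∫_y^{y-s} - ∫_y^{y-t} = ∫_{y-t}^{y-s} ≥ 0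
      have hnn : 0 ≤ ∫ σ in (y - t)..(y - s), h σ :=
        intervalIntegral.integral_nonneg (by linarith) fun σ _ => h_nn σ
      linarith
    nlinarith
  -- derivative of Bf
  have hBf_deriv : ∀ t, HasDerivAt Bf ((h (y - t) + η) * Bf t) t := by
    intro t
    have h1 : HasDerivAt (fun t => y - t) (-1) t := (hasDerivAt_id t).const_sub y
    have h2 : HasDerivAt (fun t => P (y - t)) (h (y - t) * (-1)) t :=
      (hPderiv (y - t)).comp t h1
    have h3 : HasDerivAt (fun t => -(P (y - t)) + η * t) (-(h (y - t) * (-1)) + η * 1) t :=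
      h2.neg.add ((hasDerivAt_id t).const_mul η)
    have h4 := (h3.exp).const_mul (M + η)
    refine h4.congr_deriv ?_
    simp only [hBf]; ring
  -- derivative of F t := e (y - t)
  have hF_deriv : ∀ t, HasDerivAt (fun t => e (y - t)) (e' (y - t) * (-1)) t := by
    intro t
    have h1 : HasDerivAt (fun t => y - t) (-1) t := (hasDerivAt_id t).const_sub y
    exact (hderiv (y - t)).comp t h1
  -- window induction
  have key : ∀ k : ℕ, ∀ t ∈ Icc (0:ℝ) (k * T), e (y - t) ≤ Bf t := by
    intro k
    induction k with
    | zero =>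
      intro t ht
      simp only [Nat.cast_zero, zero_mul, mem_Icc] at ht
      have ht0 : t = 0 := le_antisymm ht.2 ht.1
      subst ht0
      simpa using (htail y le_rfl).trans (hBf_ge 0 le_rfl)
    | succ k ih =>
      intro t ht
      rcases le_or_gt t (k * T) with hle | hlt
      · exact ih t ⟨ht.1, hle⟩
      -- apply the comparison lemma on [kT, (k+1)T]
      have hkT : (0:ℝ) ≤ k * T := mul_nonneg (Nat.cast_nonneg k) hT.le
      have step := image_le_of_deriv_right_lt_deriv_boundary'
        (f := fun t => e (y - t)) (f' := fun t => e' (y - t) * (-1))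
        (a := (k:ℝ) * T) (b := ((k:ℝ) + 1) * T)
        ((he_cont.comp (continuous_const.sub continuous_id)).continuousOn)
        (fun t _ => (hF_deriv t).hasDerivWithinAt)
        (B := Bf) (B' := fun t => (h (y - t) + η) * Bf t)
        (ih _ ⟨hkT, le_rfl⟩)
        (HasDerivAt.continuousOn fun t _ => hBf_deriv t)
        (fun t _ => (hBf_deriv t).hasDerivWithinAt)
        (by
          intro t htI hEq
          simp only [mem_Ico] at htI
          have ht0 : 0 ≤ t := hkT.trans htI.1
          -- the advanced value is controlled
          have hadv : e (y - t + T) ≤ Bf t := by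
            rcases lt_or_ge t T with htT | htT
            · have : y ≤ y - t + T := by linarith
              exact (htail _ this).trans (hBf_ge t ht0)
            · have hmem : t - T ∈ Icc (0:ℝ) (k * T) := by
                constructor
                · linarith
                · have := htI.2; nlinarith
              have := ih (t - T) hmem
              have hyt : y - (t - T) = y - t + T := by ring
              rw [hyt] at this
              exact this.trans (hBf_mono (t - T) t (by linarith) (by linarith))
          have hb1 := hbound (y - t)
          have hcur : e (y - t) = Bf t := hEq
          calc e' (y - t) * (-1) ≤ |e' (y - t)| := by
                  rw [mul_neg_one]; exact neg_le_abs _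
            _ ≤ a (y - t) * e (y - t + T) + b (y - t) * e (y - t) := hb1
            _ ≤ a (y - t) * Bf t + b (y - t) * Bf t := by
                  gcongr
                  · exact ha_nn _
                  · exact hb_nn _
                  · exact le_of_eq hcur
            _ = h (y - t) * Bf t := by simp only [hh]; ring
            _ < (h (y - t) + η) * Bf t := by nlinarith [hBf_pos t])
      have htmem : t ∈ Icc ((k:ℝ) * T) (((k:ℝ) + 1) * T) := by
        constructor
        · exact hlt.le
        · have := ht.2; push_cast at this; linarith
      exact step htmem
  intro t ht
  obtain ⟨k, hk⟩ : ∃ k : ℕ, t ≤ k * T := by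
    obtain ⟨k, hk⟩ := exists_nat_ge (t / T)
    exact ⟨k, by rwa [div_le_iff₀ hT] at hk⟩
  rw [hBf_eq]
  exact key k t ⟨ht, hk⟩

/-- **Effective residue bound (abstract form).** For the weighted wave identity
`e' = 2 (c₁ f(·+T) - c₂ f)` with `|f σ| ≤ C e σ g (σ - T)`, `e, g ≥ 0` continuous, `g` integrable
on `ℝ` and `e → L` at `+∞`: `e x ≤ exp (2 C (|c₁| + |c₂|) ∫ g) * L` for every `x`.
[cite: Tao2016AveragedNS, §4 (4.2)–(4.3), Lemma 4.1 (4.8)–(4.10); cell theorems A/B/B′] -/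
theorem le_exp_mul_lim_of_weighted_wave_identity {e f g : ℝ → ℝ} {T C c₁ c₂ L : ℝ}
    (hT : 0 < T) (hC : 0 ≤ C) (he_cont : Continuous e) (hf_cont : Continuous f)
    (hg_cont : Continuous g) (he_nn : ∀ x, 0 ≤ e x) (hg_nn : ∀ x, 0 ≤ g x)
    (hderiv : ∀ s, HasDerivAt e (2 * (c₁ * f (s + T) - c₂ * f s)) s)
    (hflux : ∀ σ, |f σ| ≤ C * e σ * g (σ - T)) (he_lim : Tendsto e atTop (𝓝 L))
    (hg_int : Integrable g) :
    ∀ x, e x ≤ Real.exp (2 * C * (|c₁| + |c₂|) * ∫ σ, g σ) * L := by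
  -- the two coefficient functions and their sum
  set a : ℝ → ℝ := fun x => 2 * C * |c₁| * g x with ha
  set b : ℝ → ℝ := fun x => 2 * C * |c₂| * g (x - T) with hb
  set h : ℝ → ℝ := fun x => a x + b x with hh
  have ha_cont : Continuous a := by simp only [ha]; fun_prop
  have hb_cont : Continuous b := by simp only [hb]; fun_prop
  have h_cont : Continuous h := ha_cont.add hb_cont
  have h2C : 0 ≤ 2 * C := by positivity
  have ha_nn : ∀ x, 0 ≤ a x := fun x =>
    mul_nonneg (mul_nonneg h2C (abs_nonneg _)) (hg_nn x)
  have hb_nn : ∀ x, 0 ≤ b x := fun x =>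
    mul_nonneg (mul_nonneg h2C (abs_nonneg _)) (hg_nn _)
  have h_nn : ∀ x, 0 ≤ h x := fun x => add_nonneg (ha_nn x) (hb_nn x)
  have hb_int : Integrable b := by
    simp only [hb]; exact (hg_int.comp_sub_right T).const_mul _
  have h_int : Integrable h := (hg_int.const_mul _).add hb_int
  set Htot : ℝ := ∫ σ, h σ with hHtot
  have hHtot_eq : Htot = 2 * C * (|c₁| + |c₂|) * ∫ σ, g σ := by
    simp only [hHtot, hh, ha, hb]
    rw [MeasureTheory.integral_add (hg_int.const_mul _) hb_int, MeasureTheory.integral_const_mul,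
      MeasureTheory.integral_const_mul, MeasureTheory.integral_sub_right_eq_self (fun x => g x) T]
    ring
  have hHtot_nn : 0 ≤ Htot := MeasureTheory.integral_nonneg h_nn
  -- the pointwise derivative bound
  set e' : ℝ → ℝ := fun s => 2 * (c₁ * f (s + T) - c₂ * f s) with he'
  have he'_cont : Continuous e' := by simp only [he']; fun_prop
  have hbound : ∀ x, |e' x| ≤ a x * e (x + T) + b x * e x := by
    intro x
    have h1 := hflux (x + T)
    have h2 := hflux x
    rw [add_sub_cancel_right] at h1
    have e1 : |c₁ * f (x + T)| ≤ |c₁| * (C * e (x + T) * g x) := by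
      rw [abs_mul]; exact mul_le_mul_of_nonneg_left h1 (abs_nonneg _)
    have e2 : |c₂ * f x| ≤ |c₂| * (C * e x * g (x - T)) := by
      rw [abs_mul]; exact mul_le_mul_of_nonneg_left h2 (abs_nonneg _)
    calc |e' x| = 2 * |c₁ * f (x + T) - c₂ * f x| := by
            simp only [he', abs_mul, abs_two]
      _ ≤ 2 * (|c₁ * f (x + T)| + |c₂ * f x|) := by
            gcongr; exact abs_sub _ _
      _ ≤ 2 * (|c₁| * (C * e (x + T) * g x) + |c₂| * (C * e x * g (x - T))) := by gcongr
      _ = a x * e (x + T) + b x * e x := by simp only [ha, hb]; ring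
  -- L ≥ 0
  have hL : 0 ≤ L := ge_of_tendsto' he_lim fun x => he_nn x
  -- tail integrals I y := ∫_{Ioi y} h and primitives from y
  have hI_def : ∀ y, (∫ σ in Iic y, h σ) + ∫ σ in Ioi y, h σ = Htot := by
    intro y
    have := MeasureTheory.integral_add_compl (μ := volume) (s := Iic y) measurableSet_Iic h_int
    rw [compl_Iic] at this
    rw [hHtot]; exact this
  have hI_nn : ∀ y, 0 ≤ ∫ σ in Ioi y, h σ := fun y => MeasureTheory.setIntegral_nonneg measurableSet_Ioi fun σ _ => h_nn σ
  have hPy_le : ∀ y u, ∫ σ in y..u, h σ ≤ ∫ σ in Ioi y, h σ := by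
    intro y
    have hmono : Monotone fun u => ∫ σ in y..u, h σ := by
      intro u v huv
      have := intervalIntegral.integral_interval_sub_left (f := h) (μ := volume)
        (a := y) (b := v) (c := u)
        (h_cont.intervalIntegrable _ _) (h_cont.intervalIntegrable _ _)
      have hnn : 0 ≤ ∫ σ in u..v, h σ :=
        intervalIntegral.integral_nonneg huv fun σ _ => h_nn σ
      simp only; linarith
    have htend : Tendsto (fun u => ∫ σ in y..u, h σ) atTop (𝓝 (∫ σ in Ioi y, h σ)) :=
      MeasureTheory.intervalIntegral_tendsto_integral_Ioi y h_int.integrableOn tendsto_id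
    exact fun u => hmono.ge_of_tendsto htend u
  -- Step 1: on each half-line [y, ∞) the supremum is controlled by the limit
  have step1 : ∀ y, ∃ My, 0 ≤ My ∧ (∀ x, y ≤ x → e x ≤ My) ∧
      My * (1 - ∫ σ in Ioi y, h σ) ≤ L := by
    intro y
    -- a priori bound on [y, ∞)
    obtain ⟨Y, hY⟩ : ∃ Y, ∀ x ≥ Y, e x ≤ L + 1 := by
      have := (he_lim.eventually (eventually_le_nhds (show L < L + 1 by linarith)))
      obtain ⟨Y, hY⟩ := eventually_atTop.mp this
      exact ⟨Y, hY⟩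
    obtain ⟨B₀, hB₀⟩ : ∃ B₀, ∀ x ∈ Icc y Y, e x ≤ B₀ := by
      obtain ⟨B₀, hB₀⟩ := (isCompact_Icc (a := y) (b := Y)).bddAbove_image he_cont.continuousOn
      exact ⟨B₀, fun x hx => hB₀ ⟨x, hx, rfl⟩⟩
    have hbdd : BddAbove (e '' Ici y) := by
      refine ⟨max B₀ (L + 1), ?_⟩
      rintro _ ⟨x, hx, rfl⟩
      rcases le_or_gt x Y with hxY | hxY
      · exact (hB₀ x ⟨hx, hxY⟩).trans (le_max_left _ _)
      · exact (hY x hxY.le).trans (le_max_right _ _)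
    have hne : (e '' Ici y).Nonempty := ⟨e y, y, Set.self_mem_Ici, rfl⟩
    set My := sSup (e '' Ici y) with hMy
    have hle : ∀ x, y ≤ x → e x ≤ My := fun x hx => le_csSup hbdd ⟨x, hx, rfl⟩
    have hMy_nn : 0 ≤ My := (he_nn y).trans (hle y le_rfl)
    refine ⟨My, hMy_nn, hle, ?_⟩
    -- tail step: e y' ≤ L + My * I y for y' ≥ y
    have htail : ∀ y', y ≤ y' → e y' ≤ L + My * ∫ σ in Ioi y, h σ := by
      intro y' hy'
      have hx : ∀ x, y' ≤ x → e y' ≤ e x + My * ∫ σ in Ioi y, h σ := by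
        intro x hx
        have hftc : ∫ s in y'..x, e' s = e x - e y' :=
          intervalIntegral.integral_eq_sub_of_hasDerivAt (fun s _ => hderiv s)
            (he'_cont.intervalIntegrable _ _)
        have hmono : ∫ s in y'..x, (-e' s) ≤ ∫ s in y'..x, My * h s := by
          refine intervalIntegral.integral_mono_on hx (he'_cont.neg.intervalIntegrable _ _)
            ((h_cont.const_mul My).intervalIntegrable _ _) fun s hs => ?_
          have hs' : y ≤ s := hy'.trans hs.1
          calc -e' s ≤ |e' s| := neg_le_abs _
            _ ≤ a s * e (s + T) + b s * e s := hbound s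
            _ ≤ a s * My + b s * My := by
                gcongr
                · exact ha_nn s
                · exact hle _ (by linarith)
                · exact hb_nn s
                · exact hle _ hs'
            _ = My * h s := by simp only [hh]; ring
        rw [intervalIntegral.integral_neg, hftc, intervalIntegral.integral_const_mul] at hmono
        have h3 : ∫ s in y'..x, h s ≤ ∫ σ in Ioi y, h σ := by
          have h4 : ∫ s in y..x, h s = (∫ s in y..y', h s) + ∫ s in y'..x, h s :=
            (intervalIntegral.integral_add_adjacent_intervals (h_cont.intervalIntegrable _ _)
              (h_cont.intervalIntegrable _ _)).symm
          have h5 : 0 ≤ ∫ s in y..y', h s :=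
            intervalIntegral.integral_nonneg hy' fun σ _ => h_nn σ
          linarith [hPy_le y x]
        nlinarith
      have hlim : Tendsto (fun x => e x + My * ∫ σ in Ioi y, h σ) atTop
          (𝓝 (L + My * ∫ σ in Ioi y, h σ)) := he_lim.add tendsto_const_nhds
      exact ge_of_tendsto hlim ((eventually_ge_atTop y').mono fun x hx' => hx x hx')
    have : My ≤ L + My * ∫ σ in Ioi y, h σ := by
      refine csSup_le hne ?_
      rintro _ ⟨x, hx, rfl⟩
      exact htail x hx
    linarith
  -- Step 2+3: for every x and y with I y < 1: e x ≤ exp Htot * (L / (1 - I y))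
  have step3 : ∀ x y, (∫ σ in Ioi y, h σ) < 1 →
      e x ≤ Real.exp Htot * (L / (1 - ∫ σ in Ioi y, h σ)) := by
    intro x y hIy
    obtain ⟨My, hMy_nn, hle, hMyL⟩ := step1 y
    have hMy_le : My ≤ L / (1 - ∫ σ in Ioi y, h σ) := by
      rw [le_div_iff₀ (by linarith)]; exact hMyL
    have hexp1 : (1:ℝ) ≤ Real.exp Htot := by
      rw [← Real.exp_zero]; exact Real.exp_le_exp.mpr hHtot_nn
    rcases le_or_gt y x with hyx | hxy
    · -- x ≥ y: directly
      calc e x ≤ My := hle x hyx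
        _ ≤ Real.exp Htot * My := by nlinarith
        _ ≤ Real.exp Htot * (L / (1 - ∫ σ in Ioi y, h σ)) :=
            mul_le_mul_of_nonneg_left hMy_le (Real.exp_pos _).le
    · -- x < y: backward comparison, then η → 0
      have hcmp : ∀ η, 0 < η →
          e x ≤ (My + η) * Real.exp ((∫ σ in x..y, h σ) + η * (y - x)) := by
        intro η hη
        have := backward_comparison (e := e) (e' := e') (a := a) (b := b) (T := T) (M := My)
          (y := y) (η := η) hT hη hMy_nn he_cont ha_cont hb_cont ha_nn hb_nn hderiv hbound hle
          (y - x) (by linarith)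
        simp only [sub_sub_cancel] at this
        simpa [hh] using this
      have hlim0 : e x ≤ My * Real.exp (∫ σ in x..y, h σ) := by
        have hG : Tendsto (fun η : ℝ => (My + η) * Real.exp ((∫ σ in x..y, h σ) + η * (y - x)))
            (𝓝[>] 0) (𝓝 ((My + 0) * Real.exp ((∫ σ in x..y, h σ) + 0 * (y - x)))) := by
          refine tendsto_nhdsWithin_of_tendsto_nhds ?_
          exact ((continuous_const.add continuous_id).mul
            ((continuous_const.add (continuous_id.mul continuous_const)).rexp)).tendsto 0
        simp only [add_zero, zero_mul] at hG
        exact ge_of_tendsto hG (eventually_nhdsWithin_of_forall fun η hη => hcmp η hη)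
      have hint_le : ∫ σ in x..y, h σ ≤ Htot := by
        rw [intervalIntegral.integral_of_le hxy.le, hHtot]
        exact MeasureTheory.setIntegral_le_integral h_int (Eventually.of_forall h_nn)
      calc e x ≤ My * Real.exp (∫ σ in x..y, h σ) := hlim0
        _ ≤ My * Real.exp Htot :=
            mul_le_mul_of_nonneg_left (Real.exp_le_exp.mpr hint_le) hMy_nn
        _ = Real.exp Htot * My := mul_comm _ _
        _ ≤ Real.exp Htot * (L / (1 - ∫ σ in Ioi y, h σ)) :=
            mul_le_mul_of_nonneg_left hMy_le (Real.exp_pos _).le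
  -- Step 4: the tail integral tends to 0; let y → ∞
  have hI_tend : Tendsto (fun y => ∫ σ in Ioi y, h σ) atTop (𝓝 0) := by
    have h1 : Tendsto (fun y : ℝ => ∫ σ in Iic y, h σ) atTop (𝓝 Htot) :=
      (MeasureTheory.aecover_Iic tendsto_id).integral_tendsto_of_countably_generated h_int
    have h2 : Tendsto (fun y : ℝ => Htot - ∫ σ in Iic y, h σ) atTop (𝓝 (Htot - Htot)) :=
      tendsto_const_nhds.sub h1
    rw [sub_self] at h2
    refine h2.congr fun y => ?_
    have := hI_def y
    linarith
  intro x
  have hlim : Tendsto (fun y => Real.exp Htot * (L / (1 - ∫ σ in Ioi y, h σ))) atTop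
      (𝓝 (Real.exp Htot * (L / (1 - 0)))) :=
    (tendsto_const_nhds.div (tendsto_const_nhds.sub hI_tend) (by norm_num)).const_mul _
  rw [sub_zero, div_one] at hlim
  have hev : ∀ᶠ y in atTop, e x ≤ Real.exp Htot * (L / (1 - ∫ σ in Ioi y, h σ)) :=
    (hI_tend.eventually (eventually_lt_nhds zero_lt_one)).mono fun y hy => step3 x y hy
  rw [← hHtot_eq]
  exact ge_of_tendsto hlim hev

/-- Bounded variation step: under the weighted wave identity with integrable mass, an
eventually bounded `e` has a limit at `+∞` (its derivative is integrable on a half-line).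
[cite: Tao2016AveragedNS, §4 (4.2)–(4.3), Lemma 4.1 (4.8)–(4.10); cell theorems A/B/B′] -/
theorem tendsto_of_weighted_wave_identity_of_bdd {e f g : ℝ → ℝ} {T C c₁ c₂ x₀ P : ℝ}
    (hT : 0 ≤ T) (hC : 0 ≤ C) (hf_cont : Continuous f)
    (he_nn : ∀ x, 0 ≤ e x) (hg_nn : ∀ x, 0 ≤ g x)
    (hderiv : ∀ s, HasDerivAt e (2 * (c₁ * f (s + T) - c₂ * f s)) s)
    (hflux : ∀ σ, |f σ| ≤ C * e σ * g (σ - T)) (hg_int : Integrable g)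
    (hbdd : ∀ x, x₀ ≤ x → e x ≤ P) :
    ∃ L, Tendsto e atTop (𝓝 L) := by
  set e' : ℝ → ℝ := fun s => 2 * (c₁ * f (s + T) - c₂ * f s) with he'
  have he'_cont : Continuous e' := by simp only [he']; fun_prop
  have hP : 0 ≤ P := (he_nn x₀).trans (hbdd x₀ le_rfl)
  have hm_int : Integrable fun σ => 2 * (|c₁| * (C * P * g σ) + |c₂| * (C * P * g (σ - T))) :=
    (((hg_int.const_mul _).const_mul _).add
      (((hg_int.comp_sub_right T).const_mul _).const_mul _)).const_mul _
  have hbound : ∀ σ, x₀ ≤ σ →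
      ‖e' σ‖ ≤ 2 * (|c₁| * (C * P * g σ) + |c₂| * (C * P * g (σ - T))) := by
    intro σ hσ
    rw [Real.norm_eq_abs]
    have h1 := hflux (σ + T)
    rw [add_sub_cancel_right] at h1
    have h2 := hflux σ
    have f1 : |f (σ + T)| ≤ C * P * g σ :=
      h1.trans (mul_le_mul_of_nonneg_right
        (mul_le_mul_of_nonneg_left (hbdd _ (by linarith)) hC) (hg_nn σ))
    have f2 : |f σ| ≤ C * P * g (σ - T) :=
      h2.trans (mul_le_mul_of_nonneg_right (mul_le_mul_of_nonneg_left (hbdd _ hσ) hC) (hg_nn _))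
    calc |e' σ| = 2 * |c₁ * f (σ + T) - c₂ * f σ| := by simp only [he', abs_mul, abs_two]
      _ ≤ 2 * (|c₁ * f (σ + T)| + |c₂ * f σ|) := by gcongr; exact abs_sub _ _
      _ = 2 * (|c₁| * |f (σ + T)| + |c₂| * |f σ|) := by rw [abs_mul, abs_mul]
      _ ≤ 2 * (|c₁| * (C * P * g σ) + |c₂| * (C * P * g (σ - T))) := by gcongr
  have he'_int : IntegrableOn e' (Ioi x₀) := by
    refine Integrable.mono' hm_int.integrableOn he'_cont.aestronglyMeasurable ?_
    exact (ae_restrict_iff' measurableSet_Ioi).mpr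
      (Eventually.of_forall fun σ hσ => hbound σ (le_of_lt hσ))
  have hlim : Tendsto (fun x => ∫ σ in x₀..x, e' σ) atTop (𝓝 (∫ σ in Ioi x₀, e' σ)) :=
    MeasureTheory.intervalIntegral_tendsto_integral_Ioi x₀ he'_int tendsto_id
  refine ⟨e x₀ + ∫ σ in Ioi x₀, e' σ, ?_⟩
  have hftc : ∀ x, e x = e x₀ + ∫ σ in x₀..x, e' σ := by
    intro x
    rw [intervalIntegral.integral_eq_sub_of_hasDerivAt (fun s _ => hderiv s)
      (he'_cont.intervalIntegrable _ _)]
    ring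
  have h3 : Tendsto (fun x => e x₀ + ∫ σ in x₀..x, e' σ) atTop
      (𝓝 (e x₀ + ∫ σ in Ioi x₀, e' σ)) := tendsto_const_nhds.add hlim
  exact h3.congr fun x => (hftc x).symm

/-- The weighted energy identity of an S-wave:
`(e^{2dx} Σ_r‖Φ_r x‖²)' = 2 (c₁e^{-2dT} · F̃(x+T) − c₂ · F̃(x))`, `F̃ := e^{2dx} · sFlux`.
[cite: Tao2016AveragedNS, §4 (4.2)–(4.3), Lemma 4.1 (4.8)–(4.10); cell theorems A/B/B′] -/
theorem IsSWave.hasDerivAt_weighted_sEnergy {π : Equiv.Perm ρ} {Q A : V → V} {B : V → V → V}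
    {CA d c₁ c₂ T : ℝ} (hS : STable Q A B CA) {Φ : ρ → ℝ → V}
    (hΦ : IsSWave π Q A B d c₁ c₂ T Φ) (x : ℝ) :
    HasDerivAt (fun x => Real.exp (2 * d * x) * sEnergy Φ x)
      (2 * (c₁ * Real.exp (-(2 * d * T))
        * (Real.exp (2 * d * (x + T)) * sFlux π A T Φ (x + T))
        - c₂ * (Real.exp (2 * d * x) * sFlux π A T Φ x))) x := by
  have h1 : HasDerivAt (fun x => Real.exp (2 * d * x)) (Real.exp (2 * d * x) * (2 * d * 1)) x :=
    ((hasDerivAt_id x).const_mul (2 * d)).exp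
  refine (h1.mul (hasDerivAt_sEnergy hS hΦ x)).congr_deriv ?_
  have ex1 : Real.exp (2 * d * (x + T)) = Real.exp (2 * d * x) * Real.exp (2 * d * T) := by
    rw [← Real.exp_add]; congr 1; ring
  have ex2 : Real.exp (-(2 * d * T)) * Real.exp (2 * d * T) = 1 := by
    rw [Real.exp_neg, inv_mul_cancel₀ (Real.exp_pos _).ne']
  rw [ex1]
  linear_combination (-(2 * c₁ * Real.exp (2 * d * x) * sFlux π A T Φ (x + T))) * ex2

/-- The weighted flux bound `|F̃(σ)| ≤ C_A · ẽ(σ) · Σ_r‖Φ_r(σ − T)‖`.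
[cite: Tao2016AveragedNS, §4 (4.2)–(4.3), Lemma 4.1 (4.8)–(4.10); cell theorems A/B/B′] -/
theorem IsSWave.abs_weighted_sFlux_le {π : Equiv.Perm ρ} {Q A : V → V} {B : V → V → V}
    {CA d c₁ c₂ T : ℝ} (hS : STable Q A B CA) {Φ : ρ → ℝ → V}
    (_hΦ : IsSWave π Q A B d c₁ c₂ T Φ) (σ : ℝ) :
    |Real.exp (2 * d * σ) * sFlux π A T Φ σ|
      ≤ CA * (Real.exp (2 * d * σ) * sEnergy Φ σ) * sMass Φ (σ - T) := by
  rw [abs_mul, abs_of_pos (Real.exp_pos _)]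
  calc Real.exp (2 * d * σ) * |sFlux π A T Φ σ|
      ≤ Real.exp (2 * d * σ) * (CA * sEnergy Φ σ * sMass Φ (σ - T)) :=
        mul_le_mul_of_nonneg_left (abs_sFlux_le hS π T Φ σ) (Real.exp_pos _).le
    _ = _ := by ring

/-- **THEOREM B′ (effective residue bound for S-waves).**  For an S-wave on any S-table with
integrable summed mass and weighted energy `e^{2dx} Σ_r‖Φ_r x‖²` tending to `Rsq` at `+∞`:
`e^{2dx} Σ_r‖Φ_r x‖² ≤ exp(2 C_A (|c₁| e^{-2dT} + |c₂|) ∫ Σ_r‖Φ_r‖) * Rsq` for every `x`.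
MODEL statement (abstract lattice ODE profiles); nothing here concerns Navier–Stokes.
[cite: Tao2016AveragedNS, §4 (4.2)–(4.3), Lemma 4.1 (4.8)–(4.10); cell theorems A/B/B′] -/
theorem IsSWave.weighted_sEnergy_le {π : Equiv.Perm ρ} {Q A : V → V} {B : V → V → V}
    {CA d c₁ c₂ T : ℝ} (hS : STable Q A B CA) (hT : 0 < T) {Φ : ρ → ℝ → V}
    (hΦ : IsSWave π Q A B d c₁ c₂ T Φ) (hG : Integrable (sMass Φ)) {Rsq : ℝ}
    (hR : Tendsto (fun x => Real.exp (2 * d * x) * sEnergy Φ x) atTop (𝓝 Rsq)) :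
    ∀ x, Real.exp (2 * d * x) * sEnergy Φ x
      ≤ Real.exp (2 * CA * (|c₁| * Real.exp (-(2 * d * T)) + |c₂|) * ∫ σ, sMass Φ σ) * Rsq := by
  have ce := hΦ.continuous_sEnergy
  have cF := hΦ.continuous_sFlux hS
  have hCA := hS.CA_nonneg
  have hderiv := hΦ.hasDerivAt_weighted_sEnergy hS
  have hflux := hΦ.abs_weighted_sFlux_le hS
  have key := le_exp_mul_lim_of_weighted_wave_identity
    (e := fun x => Real.exp (2 * d * x) * sEnergy Φ x)
    (f := fun x => Real.exp (2 * d * x) * sFlux π A T Φ x) (g := sMass Φ)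
    (c₁ := c₁ * Real.exp (-(2 * d * T))) (c₂ := c₂) (L := Rsq)
    hT hCA (by fun_prop) (by fun_prop) hΦ.continuous_sMass
    (fun x => mul_nonneg (Real.exp_pos _).le (sEnergy_nonneg Φ x)) (sMass_nonneg Φ)
    hderiv hflux hR hG
  have habs : |c₁ * Real.exp (-(2 * d * T))| = |c₁| * Real.exp (-(2 * d * T)) := by
    rw [abs_mul, abs_of_pos (Real.exp_pos _)]
  intro x
  rw [← habs]
  exact key x

/-- B′ in residue-fraction form: `exp(-H) · (e^{2dx} Σ_r‖Φ_r x‖²) ≤ Rsq` for every `x`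
(«the cascade keeps at least the fraction `e^{-H}` of each shell's peak weighted energy»).
[cite: Tao2016AveragedNS, §4 (4.2)–(4.3), Lemma 4.1 (4.8)–(4.10); cell theorems A/B/B′] -/
theorem IsSWave.exp_neg_action_mul_le_residue {π : Equiv.Perm ρ} {Q A : V → V}
    {B : V → V → V} {CA d c₁ c₂ T : ℝ} (hS : STable Q A B CA) (hT : 0 < T) {Φ : ρ → ℝ → V}
    (hΦ : IsSWave π Q A B d c₁ c₂ T Φ) (hG : Integrable (sMass Φ)) {Rsq : ℝ}
    (hR : Tendsto (fun x => Real.exp (2 * d * x) * sEnergy Φ x) atTop (𝓝 Rsq)) :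
    ∀ x, Real.exp (-(2 * CA * (|c₁| * Real.exp (-(2 * d * T)) + |c₂|) * ∫ σ, sMass Φ σ))
      * (Real.exp (2 * d * x) * sEnergy Φ x) ≤ Rsq := by
  intro x
  have h := hΦ.weighted_sEnergy_le hS hT hG hR x
  set H := 2 * CA * (|c₁| * Real.exp (-(2 * d * T)) + |c₂|) * ∫ σ, sMass Φ σ
  have hx : Real.exp (-H) * (Real.exp H * Rsq) = Rsq := by
    rw [← mul_assoc, ← Real.exp_add, neg_add_cancel, Real.exp_zero, one_mul]
  calc Real.exp (-H) * (Real.exp (2 * d * x) * sEnergy Φ x)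
      ≤ Real.exp (-H) * (Real.exp H * Rsq) := mul_le_mul_of_nonneg_left h (Real.exp_pos _).le
    _ = Rsq := hx

/-- Consequently a non-trivial S-wave with integrable mass has a POSITIVE residue level
(Theorem B recovered with a constant, and with the existence of the limit as a hypothesis).
[cite: Tao2016AveragedNS, §4 (4.2)–(4.3), Lemma 4.1 (4.8)–(4.10); cell theorems A/B/B′] -/
theorem IsSWave.residue_pos {π : Equiv.Perm ρ} {Q A : V → V} {B : V → V → V}
    {CA d c₁ c₂ T : ℝ} (hS : STable Q A B CA) (hT : 0 < T) {Φ : ρ → ℝ → V}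
    (hΦ : IsSWave π Q A B d c₁ c₂ T Φ) (hG : Integrable (sMass Φ)) {Rsq : ℝ}
    (hR : Tendsto (fun x => Real.exp (2 * d * x) * sEnergy Φ x) atTop (𝓝 Rsq))
    (hne : ∃ r x, Φ r x ≠ 0) : 0 < Rsq := by
  obtain ⟨r, x, hrx⟩ := hne
  have hE : 0 < sEnergy Φ x := by
    have h1 : ‖Φ r x‖ ^ 2 ≤ sEnergy Φ x :=
      Finset.single_le_sum (f := fun r' => ‖Φ r' x‖ ^ 2) (fun _ _ => by positivity)
        (Finset.mem_univ r)
    have h2 : 0 < ‖Φ r x‖ ^ 2 := by positivity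
    linarith
  have h := hΦ.exp_neg_action_mul_le_residue hS hT hG hR x
  have hpos : 0 < Real.exp (-(2 * CA * (|c₁| * Real.exp (-(2 * d * T)) + |c₂|) * ∫ σ, sMass Φ σ))
      * (Real.exp (2 * d * x) * sEnergy Φ x) :=
    mul_pos (Real.exp_pos _) (mul_pos (Real.exp_pos _) hE)
  linarith

/-- Theorem B′ for a single profile (travelling / discretely self-similar wave, `ρ = Unit`).
[cite: Tao2016AveragedNS, §4 (4.2)–(4.3), Lemma 4.1 (4.8)–(4.10); cell theorems A/B/B′] -/
theorem IsTW.weighted_energy_le {Q A : V → V} {B : V → V → V} {CA d c₁ c₂ T : ℝ}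
    (hS : STable Q A B CA) (hT : 0 < T) {Φ : ℝ → V} (hΦ : IsTW Q A B d c₁ c₂ T Φ)
    (hG : Integrable fun x => ‖Φ x‖) {Rsq : ℝ}
    (hR : Tendsto (fun x => Real.exp (2 * d * x) * ‖Φ x‖ ^ 2) atTop (𝓝 Rsq)) :
    ∀ x, Real.exp (2 * d * x) * ‖Φ x‖ ^ 2
      ≤ Real.exp (2 * CA * (|c₁| * Real.exp (-(2 * d * T)) + |c₂|) * ∫ σ, ‖Φ σ‖) * Rsq := by
  have h1 : ∀ x, sEnergy (fun _ : Unit => Φ) x = ‖Φ x‖ ^ 2 := fun x => by simp [sEnergy]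
  have h2 : ∀ x, sMass (fun _ : Unit => Φ) x = ‖Φ x‖ := fun x => by simp [sMass]
  have hm : sMass (fun _ : Unit => Φ) = fun x => ‖Φ x‖ := funext h2
  have he : (fun x => Real.exp (2 * d * x) * sEnergy (fun _ : Unit => Φ) x)
      = fun x => Real.exp (2 * d * x) * ‖Φ x‖ ^ 2 := funext fun x => by rw [h1]
  have hG' : Integrable (sMass (fun _ : Unit => Φ)) := by rw [hm]; exact hG
  have hR' : Tendsto (fun x => Real.exp (2 * d * x) * sEnergy (fun _ : Unit => Φ) x)
      atTop (𝓝 Rsq) := by rw [he]; exact hR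
  have key := hΦ.isSWave.weighted_sEnergy_le hS hT hG' hR'
  intro x
  have := key x
  rw [h1, hm] at this
  exact this

/-- **Bounded-variation step of THEOREM B′.**  If the weighted energy of an S-wave with
integrable mass is bounded on a half-line `[x₀, ∞)`, then it HAS a limit at `+∞`
(the residue level): its derivative is integrable there.
[cite: Tao2016AveragedNS, §4 (4.2)–(4.3), Lemma 4.1 (4.8)–(4.10); cell theorems A/B/B′] -/
theorem IsSWave.exists_residue_limit {π : Equiv.Perm ρ} {Q A : V → V} {B : V → V → V}
    {CA d c₁ c₂ T : ℝ} (hS : STable Q A B CA) (hT : 0 < T) {Φ : ρ → ℝ → V}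
    (hΦ : IsSWave π Q A B d c₁ c₂ T Φ) (hG : Integrable (sMass Φ)) {x₀ P : ℝ}
    (hbdd : ∀ x, x₀ ≤ x → Real.exp (2 * d * x) * sEnergy Φ x ≤ P) :
    ∃ Rsq, Tendsto (fun x => Real.exp (2 * d * x) * sEnergy Φ x) atTop (𝓝 Rsq) := by
  have cF := hΦ.continuous_sFlux hS
  exact tendsto_of_weighted_wave_identity_of_bdd
    (e := fun x => Real.exp (2 * d * x) * sEnergy Φ x)
    (f := fun x => Real.exp (2 * d * x) * sFlux π A T Φ x) (g := sMass Φ)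
    (c₁ := c₁ * Real.exp (-(2 * d * T))) (c₂ := c₂) hT.le hS.CA_nonneg (by fun_prop)
    (fun x => mul_nonneg (Real.exp_pos _).le (sEnergy_nonneg Φ x)) (sMass_nonneg Φ)
    (hΦ.hasDerivAt_weighted_sEnergy hS) (hΦ.abs_weighted_sFlux_le hS) hG hbdd

/-- **THEOREM B′, full form (hypotheses (a) integrable mass, (b) weighted energy bounded on a
half-line; as in OBSTRUCTION-MAP v5 §17).**  The residue level `Rsq = lim e^{2dx}Σ_r‖Φ_r x‖²`
EXISTS, bounds the whole weighted energy profile from above up to the action factor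
`exp(2 C_A (|c₁|e^{-2dT} + |c₂|) ∫Σ_r‖Φ_r‖)`, and is positive unless `Φ ≡ 0`.
MODEL statement about abstract lattice profile equations; nothing about Navier–Stokes.
[cite: Tao2016AveragedNS, §4 (4.2)–(4.3), Lemma 4.1 (4.8)–(4.10); cell theorems A/B/B′] -/
theorem IsSWave.theoremBprime {π : Equiv.Perm ρ} {Q A : V → V} {B : V → V → V}
    {CA d c₁ c₂ T : ℝ} (hS : STable Q A B CA) (hT : 0 < T) {Φ : ρ → ℝ → V}
    (hΦ : IsSWave π Q A B d c₁ c₂ T Φ) (hG : Integrable (sMass Φ)) {x₀ P : ℝ}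
    (hbdd : ∀ x, x₀ ≤ x → Real.exp (2 * d * x) * sEnergy Φ x ≤ P) :
    ∃ Rsq, Tendsto (fun x => Real.exp (2 * d * x) * sEnergy Φ x) atTop (𝓝 Rsq) ∧
      (∀ x, Real.exp (2 * d * x) * sEnergy Φ x
        ≤ Real.exp (2 * CA * (|c₁| * Real.exp (-(2 * d * T)) + |c₂|) * ∫ σ, sMass Φ σ) * Rsq) ∧
      ((∃ r x, Φ r x ≠ 0) → 0 < Rsq) := by
  obtain ⟨Rsq, hR⟩ := hΦ.exists_residue_limit hS hT hG hbdd
  exact ⟨Rsq, hR, hΦ.weighted_sEnergy_le hS hT hG hR, hΦ.residue_pos hS hT hG hR⟩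

end AbstractS

/-! ## Part 3.  Tao's four-mode circuit table is an `S`-table -/

section TaoCircuit

/-- Intra-shell field of Tao's circuit (signs as in theory-2 g4's
`tao_circuit_no_travelling_wave`: `ȧ ∋ -ρcd - pab - qac`, `ḃ = pa² - gc²`, `ċ = qa² + gbc`,
`ḋ ∋ ρca`).
[cite: Tao2016AveragedNS, §5 (the circuit: pump, amplifier, rotor, rectifier) and §6 Thm. 6.6 (the table); cell theorem] -/
noncomputable def circQ (ρ p q g : ℝ) (x : (Em 4)) : (Em 4) :=
  (-ρ * x 2 * x 3 - p * x 0 * x 1 - q * x 0 * x 2) • EuclideanSpace.single 0 1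
    + (p * x 0 ^ 2 - g * x 2 ^ 2) • EuclideanSpace.single 1 1
    + (q * x 0 ^ 2 + g * x 1 * x 2) • EuclideanSpace.single 2 1
    + (ρ * x 2 * x 0) • EuclideanSpace.single 3 1

/-- Outflow: mode `d` of a shell pumps mode `a` of the shell above (`ȧ_{n+1} ∋ k d_n²`).
[cite: Tao2016AveragedNS, §5 (the circuit: pump, amplifier, rotor, rectifier) and §6 Thm. 6.6 (the table); cell theorem] -/
noncomputable def circA (k : ℝ) (x : (Em 4)) : (Em 4) := (k * x 3 ^ 2) • EuclideanSpace.single 0 1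

/-- Back-reaction on the emitting shell (`ḋ_n ∋ -k d_n a_{n+1}`).
[cite: Tao2016AveragedNS, §5 (the circuit: pump, amplifier, rotor, rectifier) and §6 Thm. 6.6 (the table); cell theorem] -/
noncomputable def circB (k : ℝ) (y x : (Em 4)) : (Em 4) := (-(k * x 3 * y 0)) • EuclideanSpace.single 3 1

/-- Auxiliary. [folklore] -/
private theorem inner_single_one (x : (Em 4)) (i : Fin 4) :
    ⟪x, EuclideanSpace.single i (1:ℝ)⟫ = x i := by
  simp [EuclideanSpace.inner_single_right]

/-- Tao's circuit satisfies the abstract `S`-table hypotheses with `C_A = |k|`.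
[cite: Tao2016AveragedNS, §5 (the circuit: pump, amplifier, rotor, rectifier) and §6 Thm. 6.6 (the table); cell theorem] -/
theorem circ_sTable (ρ p q g k : ℝ) : STable (circQ ρ p q g) (circA k) (circB k) |k| where
  intra x := by
    simp only [circQ, inner_add_right, real_inner_smul_right, inner_single_one]
    ring
  cancel x y := by
    simp only [circA, circB, real_inner_smul_right, inner_single_one]
    ring
  normA x := by
    have h3 : |x 3| ≤ ‖x‖ := by
      have h := abs_real_inner_le_norm x (EuclideanSpace.single 3 (1:ℝ))
      rw [inner_single_one, PiLp.norm_single, norm_one, mul_one] at h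
      exact h
    have hsq : x 3 ^ 2 ≤ ‖x‖ ^ 2 := by
      rw [← sq_abs]; exact pow_le_pow_left₀ (abs_nonneg _) h3 2
    calc ‖circA k x‖ = |k| * x 3 ^ 2 := by simp [circA, norm_smul]
      _ ≤ |k| * ‖x‖ ^ 2 := mul_le_mul_of_nonneg_left hsq (abs_nonneg k)
  CA_nonneg := abs_nonneg k
  contA := by unfold circA; fun_prop

/-- **Theorem A for Tao's circuit, period-`q` / shape-cycling waves (`λ = 1`; referee's A-q).**
Profiles indexed by any finite `ι` with permutation `π`; trailing decay forces triviality.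
[cite: Tao2016AveragedNS, §5 (the circuit: pump, amplifier, rotor, rectifier) and §6 Thm. 6.6 (the table); cell theorem] -/
theorem tao_circuit_no_periodic_wave {ι : Type*} [Fintype ι] (π : Equiv.Perm ι)
    (ρ p q g k T : ℝ) (hT : 0 < T) {Φ : ι → ℝ → (Em 4)}
    (hΦ : IsSWave π (circQ ρ p q g) (circA k) (circB k) 0 1 1 T Φ)
    (decay : ∀ r, Tendsto (Φ r) atTop (𝓝 0)) : ∀ r x, Φ r x = 0 :=
  hΦ.eq_zero_of_trailing_decay (circ_sTable ρ p q g k) hT decay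

/-- **Theorem B for Tao's circuit (renormalised self-similar variables, any `λ`).**  With
damping `d > 0` and ANY feed/drain coefficients `c₁ c₂` (for the `λ`-lattice:
`c₁ = λ^{5/2}`, `c₂ = λ^{-5/2}`, `d = 1`), a profile family with zero residue is trivial:
a discretely self-similar blow-up of the circuit lattice cannot empty its shells at `t*`.
[cite: Tao2016AveragedNS, §5 (the circuit: pump, amplifier, rotor, rectifier) and §6 Thm. 6.6 (the table); cell theorem] -/
theorem tao_circuit_no_zero_residue_cascade {ι : Type*} [Fintype ι] (π : Equiv.Perm ι)
    (ρ p q g k d c₁ c₂ T : ℝ) (hT : 0 < T) (hd : 0 < d) {Φ : ι → ℝ → (Em 4)}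
    (hΦ : IsSWave π (circQ ρ p q g) (circA k) (circB k) d c₁ c₂ T Φ)
    (residue : ∀ r, Tendsto (fun x => Real.exp (d * x) * ‖Φ r x‖) atTop (𝓝 0)) :
    ∀ r x, Φ r x = 0 :=
  hΦ.eq_zero_of_zero_residue (circ_sTable ρ p q g k) hT hd residue

/-- Single-profile form of Theorem B for the circuit.
[cite: Tao2016AveragedNS, §5 (the circuit: pump, amplifier, rotor, rectifier) and §6 Thm. 6.6 (the table); cell theorem] -/
theorem tao_circuit_tw_no_zero_residue (ρ p q g k d c₁ c₂ T : ℝ) (hT : 0 < T) (hd : 0 < d)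
    {Φ : ℝ → (Em 4)} (hΦ : IsTW (circQ ρ p q g) (circA k) (circB k) d c₁ c₂ T Φ)
    (residue : Tendsto (fun x => Real.exp (d * x) * ‖Φ x‖) atTop (𝓝 0)) : ∀ x, Φ x = 0 :=
  hΦ.eq_zero_of_zero_residue (circ_sTable ρ p q g k) hT hd residue

/-- **Theorem B′ for Tao's circuit.**  With the circuit's structure maps (any real gains) the
action constant is `2|k|(|c₁|e^{-2dT} + |c₂|) ∫ Σ_r‖Φ_r‖` (for the `λ`-lattice in the file's
normal form: `k = λ^{5/2} K`, `c₁ = λ^{5/2}`, `c₂ = λ^{-5/2}`, `d = 1`, i.e. feed `λ⁵K`,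
drain `K`).  MODEL statement.
[cite: Tao2016AveragedNS, §5 (the circuit: pump, amplifier, rotor, rectifier) and §6 Thm. 6.6 (the table); cell theorem] -/
theorem tao_circuit_residue_bound {ι : Type*} [Fintype ι] (π : Equiv.Perm ι)
    (ρ p q g k d c₁ c₂ T : ℝ) (hT : 0 < T) {Φ : ι → ℝ → (Em 4)}
    (hΦ : IsSWave π (circQ ρ p q g) (circA k) (circB k) d c₁ c₂ T Φ)
    (hG : Integrable (sMass Φ)) {Rsq : ℝ}
    (hR : Tendsto (fun x => Real.exp (2 * d * x) * sEnergy Φ x) atTop (𝓝 Rsq)) :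
    ∀ x, Real.exp (2 * d * x) * sEnergy Φ x
      ≤ Real.exp (2 * |k| * (|c₁| * Real.exp (-(2 * d * T)) + |c₂|) * ∫ σ, sMass Φ σ) * Rsq :=
  hΦ.weighted_sEnergy_le (circ_sTable ρ p q g k) hT hG hR

/-- … and a non-trivial circuit cascade with integrable mass has a positive residue level.
[cite: Tao2016AveragedNS, §5 (the circuit: pump, amplifier, rotor, rectifier) and §6 Thm. 6.6 (the table); cell theorem] -/
theorem tao_circuit_residue_pos {ι : Type*} [Fintype ι] (π : Equiv.Perm ι)
    (ρ p q g k d c₁ c₂ T : ℝ) (hT : 0 < T) {Φ : ι → ℝ → (Em 4)}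
    (hΦ : IsSWave π (circQ ρ p q g) (circA k) (circB k) d c₁ c₂ T Φ)
    (hG : Integrable (sMass Φ)) {Rsq : ℝ}
    (hR : Tendsto (fun x => Real.exp (2 * d * x) * sEnergy Φ x) atTop (𝓝 Rsq))
    (hne : ∃ r x, Φ r x ≠ 0) : 0 < Rsq :=
  hΦ.residue_pos (circ_sTable ρ p q g k) hT hG hR hne

/-- **THEOREM B′ (full form) for Tao's circuit.**  MODEL statement.
[cite: Tao2016AveragedNS, §5 (the circuit: pump, amplifier, rotor, rectifier) and §6 Thm. 6.6 (the table); cell theorem] -/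
theorem tao_circuit_theoremBprime {ι : Type*} [Fintype ι] (π : Equiv.Perm ι)
    (ρ p q g k d c₁ c₂ T : ℝ) (hT : 0 < T) {Φ : ι → ℝ → (Em 4)}
    (hΦ : IsSWave π (circQ ρ p q g) (circA k) (circB k) d c₁ c₂ T Φ)
    (hG : Integrable (sMass Φ)) {x₀ P : ℝ}
    (hbdd : ∀ x, x₀ ≤ x → Real.exp (2 * d * x) * sEnergy Φ x ≤ P) :
    ∃ Rsq, Tendsto (fun x => Real.exp (2 * d * x) * sEnergy Φ x) atTop (𝓝 Rsq) ∧
      (∀ x, Real.exp (2 * d * x) * sEnergy Φ x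
        ≤ Real.exp (2 * |k| * (|c₁| * Real.exp (-(2 * d * T)) + |c₂|) * ∫ σ, sMass Φ σ) * Rsq) ∧
      ((∃ r x, Φ r x ≠ 0) → 0 < Rsq) :=
  hΦ.theoremBprime (circ_sTable ρ p q g k) hT hG hbdd

end TaoCircuit

/-! ## Part 5.  From a structure-constant table on Tao's shift set to an abstract `S`-table -/


section TableDictionary

variable {m : ℕ}

/-- `⟪x, e_i⟫ = x_i` on `ℝ^m`. [folklore] -/
private theorem inner_single_one' (x : Em m) (i : Fin m) :
    ⟪x, EuclideanSpace.single i (1 : ℝ)⟫ = x i := by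
  simp [EuclideanSpace.inner_single_right]

/-- `⟪y, Σ_i c_i e_i⟫ = Σ_i c_i y_i` on `ℝ^m`. [folklore] -/
private theorem inner_sum_single (y : Em m) (c : Fin m → ℝ) :
    ⟪y, ∑ i, c i • EuclideanSpace.single i (1 : ℝ)⟫ = ∑ i, c i * y i := by
  rw [inner_sum]
  refine Finset.sum_congr rfl fun i _ => ?_
  rw [real_inner_smul_right, inner_single_one']

/-- Swap of the first two indices of a triple sum. [folklore] -/
private theorem sum3_swap12 (F : Fin m → Fin m → Fin m → ℝ) :
    (∑ a, ∑ b, ∑ c, F b a c) = ∑ a, ∑ b, ∑ c, F a b c := Finset.sum_comm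

/-- Swap of the last two indices of a triple sum. [folklore] -/
private theorem sum3_swap23 (F : Fin m → Fin m → Fin m → ℝ) :
    (∑ a, ∑ b, ∑ c, F a c b) = ∑ a, ∑ b, ∑ c, F a b c :=
  Finset.sum_congr rfl fun _ _ => Finset.sum_comm


/-- Pointwise congruence of triple sums. [folklore] -/
private theorem sum3_congr {F G : Fin m → Fin m → Fin m → ℝ} (h : ∀ a b c, F a b c = G a b c) :
    (∑ a, ∑ b, ∑ c, F a b c) = ∑ a, ∑ b, ∑ c, G a b c :=
  Finset.sum_congr rfl fun a _ => Finset.sum_congr rfl fun b _ =>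
    Finset.sum_congr rfl fun c _ => h a b c

/-- Six-permutation cancellation of a cubic form with a fully symmetric weight.
[cite: Tao2016AveragedNS, §4 (4.1)–(4.3) and Lemma 4.1 (4.8); cell dictionary] -/
theorem cubic_sum_eq_zero (f : Fin m → Fin m → Fin m → ℝ) (w : Fin m → Fin m → Fin m → ℝ)
    (w12 : ∀ a b c, w b a c = w a b c) (w23 : ∀ a b c, w a c b = w a b c)
    (h : ∀ a b c, f a b c + f a c b + f b a c + f b c a + f c a b + f c b a = 0) :
    (∑ a, ∑ b, ∑ c, f a b c * w a b c) = 0 := by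
  set S := ∑ a, ∑ b, ∑ c, f a b c * w a b c with hS
  -- each permuted sum equals `S`
  have e_acb : (∑ a, ∑ b, ∑ c, f a c b * w a b c) = S := by
    rw [hS, ← sum3_swap23 (fun a b c => f a b c * w a b c)]
    exact sum3_congr fun a b c => by rw [w23]
  have e_bac : (∑ a, ∑ b, ∑ c, f b a c * w a b c) = S := by
    rw [hS, ← sum3_swap12 (fun a b c => f a b c * w a b c)]
    exact sum3_congr fun a b c => by rw [w12]
  have e_cba : (∑ a, ∑ b, ∑ c, f c b a * w a b c) = S := by
    -- (13) = (12)(23)(12)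
    have h1 : (∑ a, ∑ b, ∑ c, f c b a * w a b c) = ∑ a, ∑ b, ∑ c, f c a b * w a b c := by
      rw [← sum3_swap12 (fun a b c => f c a b * w a b c)]
      exact sum3_congr fun a b c => by rw [w12]
    have h2 : (∑ a, ∑ b, ∑ c, f c a b * w a b c) = ∑ a, ∑ b, ∑ c, f b a c * w a b c := by
      rw [← sum3_swap23 (fun a b c => f b a c * w a b c)]
      exact sum3_congr fun a b c => by rw [w23]
    rw [h1, h2, e_bac]
  have e_bca : (∑ a, ∑ b, ∑ c, f b c a * w a b c) = S := by
    have h1 : (∑ a, ∑ b, ∑ c, f b c a * w a b c) = ∑ a, ∑ b, ∑ c, f a c b * w a b c := by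
      rw [← sum3_swap12 (fun a b c => f a c b * w a b c)]
      exact sum3_congr fun a b c => by rw [w12]
    rw [h1, e_acb]
  have e_cab : (∑ a, ∑ b, ∑ c, f c a b * w a b c) = S := by
    have h2 : (∑ a, ∑ b, ∑ c, f c a b * w a b c) = ∑ a, ∑ b, ∑ c, f b a c * w a b c := by
      rw [← sum3_swap23 (fun a b c => f b a c * w a b c)]
      exact sum3_congr fun a b c => by rw [w23]
    rw [h2, e_bac]
  have h6 : 6 * S = 0 := by
    have : (∑ a, ∑ b, ∑ c,
        (f a b c + f a c b + f b a c + f b c a + f c a b + f c b a) * w a b c) = 0 :=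
      Finset.sum_eq_zero fun a _ => Finset.sum_eq_zero fun b _ =>
        Finset.sum_eq_zero fun c _ => by rw [h a b c, zero_mul]
    have expand : (∑ a, ∑ b, ∑ c,
        (f a b c + f a c b + f b a c + f b c a + f c a b + f c b a) * w a b c)
        = S + (∑ a, ∑ b, ∑ c, f a c b * w a b c) + (∑ a, ∑ b, ∑ c, f b a c * w a b c)
          + (∑ a, ∑ b, ∑ c, f b c a * w a b c) + (∑ a, ∑ b, ∑ c, f c a b * w a b c)
          + (∑ a, ∑ b, ∑ c, f c b a * w a b c) := by
      simp only [add_mul, Finset.sum_add_distrib, hS]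
    rw [expand, e_acb, e_bac, e_bca, e_cab, e_cba] at this
    linarith
  linarith

/-- `Σ_c Σ_a Σ_b` to `Σ_a Σ_b Σ_c` (move the outer index inside).
[cite: Tao2016AveragedNS, §4 (4.1)–(4.3) and Lemma 4.1 (4.8); cell dictionary] -/
theorem sum3_rotate (F : Fin m → Fin m → Fin m → ℝ) :
    (∑ c, ∑ a, ∑ b, F a b c) = ∑ a, ∑ b, ∑ c, F a b c := by
  rw [Finset.sum_comm]
  exact Finset.sum_congr rfl fun a _ => Finset.sum_comm

/-- `Σ_b Σ_c Σ_a` to `Σ_a Σ_b Σ_c`.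
[cite: Tao2016AveragedNS, §4 (4.1)–(4.3) and Lemma 4.1 (4.8); cell dictionary] -/
theorem sum3_rotate' (F : Fin m → Fin m → Fin m → ℝ) :
    (∑ b, ∑ c, ∑ a, F a b c) = ∑ a, ∑ b, ∑ c, F a b c :=
  calc (∑ b, ∑ c, ∑ a, F a b c) = ∑ b, ∑ a, ∑ c, F a b c :=
        Finset.sum_congr rfl fun _ _ => Finset.sum_comm
    _ = ∑ a, ∑ b, ∑ c, F a b c := Finset.sum_comm

/-- `|x j| ≤ ‖x‖` in `ℝ^m`.
[cite: Tao2016AveragedNS, §4 (4.1)–(4.3) and Lemma 4.1 (4.8); cell dictionary] -/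
theorem abs_apply_le_norm (x : Em m) (j : Fin m) : |x j| ≤ ‖x‖ := by
  have h := abs_real_inner_le_norm x (EuclideanSpace.single j (1 : ℝ))
  rw [inner_single_one', PiLp.norm_single, norm_one, mul_one] at h
  exact h

/-- **A cancelling table on Tao's shift set is an abstract `S`-table** (Part 2's `STable`) with
`C_A = fluxConst α`: intra-shell neutrality from (4.3) at `μ = (0,0,0)`, the type-split cancellation
`⟪y, A x⟫ + ⟪x, B y x⟫ = 0` from (4.3) at `μ = (0,0,1)` (whose permutation orbit is
`{(001),(010),(100)}`), and the flux bound from `|x_j| ≤ ‖x‖`.  Symmetry (4.2) is not needed.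
[cite: Tao2016AveragedNS, §4 (4.1)–(4.3) and Lemma 4.1 (4.8); cell dictionary] -/
theorem table_sTable (α : Fin m → Fin m → Fin m → ℤ × ℤ × ℤ → ℝ) (hc : IsCancellingCoeff α) :
    STable (tableQ α) (tableA α) (tableB α) (fluxConst α) where
  intra x := by
    unfold tableQ
    rw [inner_sum_single]
    -- ⟪x, Q x⟫ = Σ_c (Σ_a Σ_b α a b c (000) x_a x_b) x_c
    have step : (∑ i, qform α (0, 0, 0) x x i * x i)
        = ∑ a, ∑ b, ∑ c, α a b c (0, 0, 0) * (x a * x b * x c) := by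
      unfold qform
      rw [← sum3_rotate]
      refine Finset.sum_congr rfl fun c _ => ?_
      rw [Finset.sum_mul]
      refine Finset.sum_congr rfl fun a _ => ?_
      rw [Finset.sum_mul]
      exact Finset.sum_congr rfl fun b _ => by ring
    rw [step]
    have h000 : ((0 : ℤ), (0 : ℤ), (0 : ℤ)) ∈ shiftSet := by simp [shiftSet]
    exact cubic_sum_eq_zero (fun a b c => α a b c (0, 0, 0)) (fun a b c => x a * x b * x c)
      (fun a b c => by ring) (fun a b c => by ring) (fun a b c => hc a b c 0 0 0 h000)
  cancel x y := by
    unfold tableA tableB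
    rw [inner_sum_single, inner_sum_single]
    have stepA : (∑ i, qform α (0, 0, 1) x x i * y i)
        = ∑ a, ∑ b, ∑ c, α a b c (0, 0, 1) * (x a * x b * y c) := by
      unfold qform
      rw [← sum3_rotate]
      refine Finset.sum_congr rfl fun c _ => ?_
      rw [Finset.sum_mul]
      refine Finset.sum_congr rfl fun a _ => ?_
      rw [Finset.sum_mul]
      exact Finset.sum_congr rfl fun b _ => by ring
    -- the (100) part: Σ_i (Σ_{i₁ i₂} α i₁ i₂ i (100) y_{i₁} x_{i₂}) x_i, reindexed to the weight
    -- x_a x_b y_c with (i₁, i₂, i) = (c, a, b)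
    have stepB1 : (∑ i, qform α (1, 0, 0) y x i * x i)
        = ∑ a, ∑ b, ∑ c, α c a b (1, 0, 0) * (x a * x b * y c) := by
      unfold qform
      -- Σ_i Σ_{i₁} Σ_{i₂} α i₁ i₂ i (100) (y i₁ x i₂) x i : names (i,i₁,i₂) = (b,c,a)
      have : (∑ i, (∑ i₁, ∑ i₂, α i₁ i₂ i (1, 0, 0) * (y i₁ * x i₂)) * x i)
          = ∑ b, ∑ c, ∑ a, α c a b (1, 0, 0) * (x a * x b * y c) := by
        refine Finset.sum_congr rfl fun b _ => ?_
        rw [Finset.sum_mul]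
        refine Finset.sum_congr rfl fun c _ => ?_
        rw [Finset.sum_mul]
        exact Finset.sum_congr rfl fun a _ => by ring
      rw [this]
      exact sum3_rotate' (fun a b c => α c a b (1, 0, 0) * (x a * x b * y c))
    have stepB2 : (∑ i, qform α (0, 1, 0) x y i * x i)
        = ∑ a, ∑ b, ∑ c, α a c b (0, 1, 0) * (x a * x b * y c) := by
      unfold qform
      -- Σ_i Σ_{i₁} Σ_{i₂} α i₁ i₂ i (010) (x i₁ y i₂) x i : names (i,i₁,i₂) = (b,a,c)
      have : (∑ i, (∑ i₁, ∑ i₂, α i₁ i₂ i (0, 1, 0) * (x i₁ * y i₂)) * x i)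
          = ∑ b, ∑ a, ∑ c, α a c b (0, 1, 0) * (x a * x b * y c) := by
        refine Finset.sum_congr rfl fun b _ => ?_
        rw [Finset.sum_mul]
        refine Finset.sum_congr rfl fun a _ => ?_
        rw [Finset.sum_mul]
        exact Finset.sum_congr rfl fun c _ => by ring
      rw [this, Finset.sum_comm]
    have split : (∑ i, (qform α (1, 0, 0) y x i + qform α (0, 1, 0) x y i) * x i)
        = (∑ i, qform α (1, 0, 0) y x i * x i) + ∑ i, qform α (0, 1, 0) x y i * x i := by
      rw [← Finset.sum_add_distrib]
      exact Finset.sum_congr rfl fun i _ => by ring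
    rw [split, stepA, stepB1, stepB2]
    -- now use (4.3) at μ = (0,0,1), weight w a b c = x a * x b * y c (symmetric in a b only)
    have h001 : ((0 : ℤ), (0 : ℤ), (1 : ℤ)) ∈ shiftSet := by simp [shiftSet]
    have hsum : (∑ a, ∑ b, ∑ c,
        (α a b c (0, 0, 1) + α a c b (0, 1, 0) + α b a c (0, 0, 1) + α b c a (0, 1, 0)
          + α c a b (1, 0, 0) + α c b a (1, 0, 0)) * (x a * x b * y c)) = 0 :=
      Finset.sum_eq_zero fun a _ => Finset.sum_eq_zero fun b _ =>
        Finset.sum_eq_zero fun c _ => by rw [hc a b c 0 0 1 h001, zero_mul]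
    have w12 : ∀ a b c : Fin m, x b * x a * y c = x a * x b * y c := fun a b c => by ring
    have t3 : (∑ a, ∑ b, ∑ c, α b a c (0, 0, 1) * (x a * x b * y c))
        = ∑ a, ∑ b, ∑ c, α a b c (0, 0, 1) * (x a * x b * y c) := by
      rw [← sum3_swap12 (fun a b c => α a b c (0, 0, 1) * (x a * x b * y c))]
      exact sum3_congr fun a b c => by rw [w12]
    have t4 : (∑ a, ∑ b, ∑ c, α b c a (0, 1, 0) * (x a * x b * y c))
        = ∑ a, ∑ b, ∑ c, α a c b (0, 1, 0) * (x a * x b * y c) := by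
      rw [← sum3_swap12 (fun a b c => α a c b (0, 1, 0) * (x a * x b * y c))]
      exact sum3_congr fun a b c => by rw [w12]
    have t6 : (∑ a, ∑ b, ∑ c, α c b a (1, 0, 0) * (x a * x b * y c))
        = ∑ a, ∑ b, ∑ c, α c a b (1, 0, 0) * (x a * x b * y c) := by
      rw [← sum3_swap12 (fun a b c => α c a b (1, 0, 0) * (x a * x b * y c))]
      exact sum3_congr fun a b c => by rw [w12]
    have expand : (∑ a, ∑ b, ∑ c,
        (α a b c (0, 0, 1) + α a c b (0, 1, 0) + α b a c (0, 0, 1) + α b c a (0, 1, 0)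
          + α c a b (1, 0, 0) + α c b a (1, 0, 0)) * (x a * x b * y c))
        = (∑ a, ∑ b, ∑ c, α a b c (0, 0, 1) * (x a * x b * y c))
          + (∑ a, ∑ b, ∑ c, α a c b (0, 1, 0) * (x a * x b * y c))
          + (∑ a, ∑ b, ∑ c, α b a c (0, 0, 1) * (x a * x b * y c))
          + (∑ a, ∑ b, ∑ c, α b c a (0, 1, 0) * (x a * x b * y c))
          + (∑ a, ∑ b, ∑ c, α c a b (1, 0, 0) * (x a * x b * y c))
          + (∑ a, ∑ b, ∑ c, α c b a (1, 0, 0) * (x a * x b * y c)) := by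
      simp only [add_mul, Finset.sum_add_distrib]
    rw [expand, t3, t4, t6] at hsum
    linarith
  normA x := by
    unfold tableA
    calc ‖∑ i, qform α (0, 0, 1) x x i • EuclideanSpace.single i (1 : ℝ)‖
        ≤ ∑ i, ‖qform α (0, 0, 1) x x i • EuclideanSpace.single i (1 : ℝ)‖ := norm_sum_le _ _
      _ = ∑ i, |qform α (0, 0, 1) x x i| := by
          refine Finset.sum_congr rfl fun i _ => ?_
          rw [norm_smul, PiLp.norm_single, norm_one, mul_one, Real.norm_eq_abs]
      _ ≤ ∑ i, (∑ i₁, ∑ i₂, |α i₁ i₂ i (0, 0, 1)|) * ‖x‖ ^ 2 := by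
          refine Finset.sum_le_sum fun i _ => ?_
          unfold qform
          calc |∑ i₁, ∑ i₂, α i₁ i₂ i (0, 0, 1) * (x i₁ * x i₂)|
              ≤ ∑ i₁, |∑ i₂, α i₁ i₂ i (0, 0, 1) * (x i₁ * x i₂)| := Finset.abs_sum_le_sum_abs _ _
            _ ≤ ∑ i₁, ∑ i₂, |α i₁ i₂ i (0, 0, 1) * (x i₁ * x i₂)| :=
                Finset.sum_le_sum fun i₁ _ => Finset.abs_sum_le_sum_abs _ _
            _ ≤ ∑ i₁, ∑ i₂, |α i₁ i₂ i (0, 0, 1)| * ‖x‖ ^ 2 := by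
                refine Finset.sum_le_sum fun i₁ _ => Finset.sum_le_sum fun i₂ _ => ?_
                rw [abs_mul, abs_mul]
                refine mul_le_mul_of_nonneg_left ?_ (abs_nonneg _)
                calc |x i₁| * |x i₂| ≤ ‖x‖ * ‖x‖ :=
                      mul_le_mul (abs_apply_le_norm x i₁) (abs_apply_le_norm x i₂) (abs_nonneg _)
                        (norm_nonneg _)
                  _ = ‖x‖ ^ 2 := (sq ‖x‖).symm
            _ = (∑ i₁, ∑ i₂, |α i₁ i₂ i (0, 0, 1)|) * ‖x‖ ^ 2 := by
                rw [Finset.sum_mul]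
                exact Finset.sum_congr rfl fun i₁ _ => by rw [Finset.sum_mul]
      _ = fluxConst α * ‖x‖ ^ 2 := by rw [fluxConst, Finset.sum_mul]
  CA_nonneg := fluxConst_nonneg α
  contA := by
    unfold tableA qform
    fun_prop

/-- On an `R`-comparable table the flux constant is at most `m³` (uniform over the class E₂(R)).
[cite: Tao2016AveragedNS, §4 (4.1)–(4.3) and Lemma 4.1 (4.8); cell dictionary] -/
theorem fluxConst_le_of_abs_le_one (α : Fin m → Fin m → Fin m → ℤ × ℤ × ℤ → ℝ)
    (h : ∀ i₁ i₂ i₃, |α i₁ i₂ i₃ (0, 0, 1)| ≤ 1) : fluxConst α ≤ (m : ℝ) ^ 3 := by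
  unfold fluxConst
  calc (∑ i, ∑ i₁, ∑ i₂, |α i₁ i₂ i (0, 0, 1)|)
      ≤ ∑ _i : Fin m, ∑ _i₁ : Fin m, ∑ _i₂ : Fin m, (1 : ℝ) :=
        Finset.sum_le_sum fun i _ => Finset.sum_le_sum fun i₁ _ =>
          Finset.sum_le_sum fun i₂ _ => h i₁ i₂ i
    _ = (m : ℝ) ^ 3 := by simp; ring

end TableDictionary

/-! ## Part 5 (continued).  The typed NEGATIVE side of rung 2: admissible DSS waves of a table,
(S)-survival, `NoSurvivingDSS` (K1), `BlowupRigidity` (K2), the kernel implication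
`K1 → K2 → RungTwoBreakLatt`, the front-sum bookkeeping (17.3) with THEOREM B″ (width of a DSS
wave), and the ε₀-renormalised action–width ceiling with its kernel reduction to K1. -/


section FrontSums

/-! ### 5.3  Front-sum bookkeeping (OBSTRUCTION-MAP §17.3 (c), pure real analysis)

For a DSS wave with per-shell energy ratio `μ` and delay `T`, the shells `k = 0, 1, 2, …` steps
AHEAD of a reference shell carry, at the reference shell's phase `x`, the renormalised energies
`μ^k ẽ(x - kT)` (in units of the reference shell's scale weight).  The partial sums over `k < K`
are the finite "front sums"; their supremum over `(K, x)` divided by the peak `P = sup ẽ` is the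
energy-weighted number of simultaneously charged shells (the WIDTH functional `W` of v5 §17.3). -/

/-- Partial front sum `Σ_{k<K} μ^k e(x - kT)`.
[cite: Tao2016AveragedNS, §6.4 (energy bookkeeping of the self-similar cascade); cell bookkeeping (real analysis)] -/
def frontSum (μ T : ℝ) (e : ℝ → ℝ) (K : ℕ) (x : ℝ) : ℝ :=
  ∑ k ∈ Finset.range K, μ ^ k * e (x - k * T)

/-- Auxiliary. [folklore] -/
private theorem tendsto_sub_const_atTop_real (c : ℝ) : Tendsto (fun x : ℝ => x - c) atTop atTop := by
  simpa [sub_eq_add_neg] using tendsto_atTop_add_const_right atTop (-c) tendsto_id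

/-- If `e → L` at `+∞` then the `K`-th front sum tends to `(Σ_{k<K} μ^k)·L`.
[cite: Tao2016AveragedNS, §6.4 (energy bookkeeping of the self-similar cascade); cell bookkeeping (real analysis)] -/
theorem frontSum_tendsto {e : ℝ → ℝ} {L : ℝ} (he : Tendsto e atTop (𝓝 L)) (μ T : ℝ) (K : ℕ) :
    Tendsto (frontSum μ T e K) atTop (𝓝 ((∑ k ∈ Finset.range K, μ ^ k) * L)) := by
  unfold frontSum
  rw [Finset.sum_mul]
  refine tendsto_finsetSum _ fun k _ => ?_
  exact (he.comp (tendsto_sub_const_atTop_real ((k : ℝ) * T))).const_mul _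

/-- A uniform bound on the `K`-th front sum bounds `(Σ_{k<K} μ^k)·L`.
[cite: Tao2016AveragedNS, §6.4 (energy bookkeeping of the self-similar cascade); cell bookkeeping (real analysis)] -/
theorem geom_mul_le_of_frontSum_le {e : ℝ → ℝ} {L M μ T : ℝ} (he : Tendsto e atTop (𝓝 L))
    (K : ℕ) (hM : ∀ x, frontSum μ T e K x ≤ M) : (∑ k ∈ Finset.range K, μ ^ k) * L ≤ M :=
  le_of_tendsto' (frontSum_tendsto he μ T K) hM

/-- With `0 ≤ μ < 1`, a bound on all front sums bounds `L/(1-μ)` (the residues of the infinitely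
many charged shells ahead add up).
[cite: Tao2016AveragedNS, §6.4 (energy bookkeeping of the self-similar cascade); cell bookkeeping (real analysis)] -/
theorem residue_div_le_of_frontSum_le {e : ℝ → ℝ} {L M μ T : ℝ} (he : Tendsto e atTop (𝓝 L))
    (hμ0 : 0 ≤ μ) (hμ1 : μ < 1) (hM : ∀ K x, frontSum μ T e K x ≤ M) :
    L / (1 - μ) ≤ M := by
  have hgeo : Tendsto (fun K => (∑ k ∈ Finset.range K, μ ^ k) * L) atTop
      (𝓝 ((1 - μ)⁻¹ * L)) :=
    ((hasSum_geometric_of_lt_one hμ0 hμ1).tendsto_sum_nat).mul_const L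
  have h := le_of_tendsto' hgeo (fun K => geom_mul_le_of_frontSum_le he K (hM K))
  rw [div_eq_inv_mul]
  exact h

/-- Monotonicity of front sums in `μ` for a non-negative profile.
[cite: Tao2016AveragedNS, §6.4 (energy bookkeeping of the self-similar cascade); cell bookkeeping (real analysis)] -/
theorem frontSum_mono_mu {e : ℝ → ℝ} (he : ∀ x, 0 ≤ e x) {μ ν : ℝ} (hν : 0 ≤ ν) (hle : ν ≤ μ)
    (T : ℝ) (K : ℕ) (x : ℝ) : frontSum ν T e K x ≤ frontSum μ T e K x :=
  Finset.sum_le_sum fun k _ =>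
    mul_le_mul_of_nonneg_right (pow_le_pow_left₀ hν hle k) (he _)

end FrontSums

section DSSWaves

variable {ρ : Type*} [Fintype ρ]
variable {m : ℕ}

/-! ### 5.4  The rung-2 vocabulary of theory-1 (VERBATIM COPIES)

The five declarations below are copied byte-for-byte (modulo this docstring and the namespace)
from theory-1's cell file `rung2/TaoLadderRung2.lean` v3 `2dd48acf15bf5bd4` (ll. 87, 95–97,
102–103, 112–114, 165–169; namespace `Summit.NavierStokesRegularity.TaoLadder`), which cannot be
imported from a cell file.  When the topic `Summits/NavierStokesRegularity/TaoLadder` opens, both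
files import the tree module and this namespace is deleted; the glue theorems below then conclude
theory-1's `RungTwoBreakLatt` BY NAME. -/
/-! ### 5.5  Admissible DSS waves of a table, their residue theorem, and (S)-survival -/

/-- **THEOREM B′ for admissible DSS waves of a cancelling table** (Part 4 + `table_sTable`): the
residue level `Rsq = lim ẽ` exists, `ẽ ≤ e^{H} Rsq` everywhere, and `Rsq > 0` unless `Φ ≡ 0`.
[cite: Tao2016AveragedNS, §4 Thm. 4.2 (statement shape), §6.4; cell theorems B′/B″] -/
theorem IsDSSWave.theoremBprime {ε₀ : ℝ} {α : Fin m → Fin m → Fin m → ℤ × ℤ × ℤ → ℝ}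
    {π : Equiv.Perm ρ} {T : ℝ} {Φ : ρ → ℝ → Em m} (hc : IsCancellingCoeff α)
    (h : IsDSSWave ε₀ α π T Φ) :
    ∃ Rsq, Tendsto (wEnergy 1 Φ) atTop (𝓝 Rsq) ∧
      (∀ x, wEnergy 1 Φ x ≤ Real.exp (dssAction ε₀ α T Φ) * Rsq) ∧
      ((∃ r x, Φ r x ≠ 0) → 0 < Rsq) := by
  obtain ⟨x₀, P, hP⟩ := h.bdd
  exact h.wave.theoremBprime (table_sTable α hc) h.delay_pos h.mass (x₀ := x₀) (P := P) hP

/-! ### 5.6  K1, K2 and the kernel implication `K1 → K2 → RungTwoBreakLatt` -/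

/-! ### 5.7  THEOREM B″ (width of a DSS wave) and the ε₀-renormalised action–width ceiling -/

/-- **THEOREM B″ — the width of a sub-unitary DSS wave.**  If all front sums of an admissible DSS
wave of a cancelling table with `0 ≤ μ < 1` are bounded by `M`, then `Rsq/(1-μ) ≤ M` where
`Rsq = lim ẽ > 0` (for `Φ ≢ 0`) is THEOREM B′'s residue level, and `ẽ ≤ e^{H} Rsq`; hence the
energy-weighted number of simultaneously charged shells `M/P` (`P = sup ẽ`) is at least
`e^{-H}/(1-μ)` — an (S)-surviving wave (`1-μ ≤ 1-λ^{-a} ≈ aε₀`) is at least `≈ e^{-H}/(aε₀)`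
shells wide.  MODEL statement (lattice profile equations).
[cite: Tao2016AveragedNS, §4 Thm. 4.2 (statement shape), §6.4; cell theorems B′/B″] -/
theorem IsDSSWave.width_lower_bound {ε₀ : ℝ} {α : Fin m → Fin m → Fin m → ℤ × ℤ × ℤ → ℝ}
    {π : Equiv.Perm ρ} {T : ℝ} {Φ : ρ → ℝ → Em m} (hc : IsCancellingCoeff α)
    (h : IsDSSWave ε₀ α π T Φ) (hμ0 : 0 ≤ dssMu ε₀ T) (hμ1 : dssMu ε₀ T < 1) {M : ℝ}
    (hM : ∀ K x, frontSum (dssMu ε₀ T) T (wEnergy 1 Φ) K x ≤ M) :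
    ∃ Rsq, Tendsto (wEnergy 1 Φ) atTop (𝓝 Rsq) ∧ Rsq / (1 - dssMu ε₀ T) ≤ M ∧
      (∀ x, wEnergy 1 Φ x ≤ Real.exp (dssAction ε₀ α T Φ) * Rsq) ∧
      ((∃ r x, Φ r x ≠ 0) → 0 < Rsq) := by
  obtain ⟨Rsq, hR, hle, hpos⟩ := h.theoremBprime hc
  exact ⟨Rsq, hR, residue_div_le_of_frontSum_le hR hμ0 hμ1 hM, hle, hpos⟩

/-- **THEOREM B for admissible DSS waves (zero residue ⇒ trivial).**  An admissible DSS wave of a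
cancelling table whose weighted energy `ẽ = e^{2x}Σ_r‖Φ_r x‖²` tends to `0` at `+∞` (it leaves no
residue behind the front) is identically zero — for EVERY scale ratio, delay and table; the
residue level of B′ is positive for a non-trivial wave.
[cite: Tao2016AveragedNS, §4 (4.3) (cancellation) and Lemma 4.1 (4.9)–(4.10) (energy identity), §6.4; cell theorem B] -/
theorem IsDSSWave.eq_zero_of_residue_zero {ε₀ : ℝ} {α : Fin m → Fin m → Fin m → ℤ × ℤ × ℤ → ℝ}
    {π : Equiv.Perm ρ} {T : ℝ} {Φ : ρ → ℝ → Em m} (hc : IsCancellingCoeff α)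
    (h : IsDSSWave ε₀ α π T Φ) (h0 : Tendsto (wEnergy 1 Φ) atTop (𝓝 0)) : ∀ r x, Φ r x = 0 := by
  obtain ⟨Rsq, hR, -, hpos⟩ := h.theoremBprime hc
  have hRsq : Rsq = 0 := tendsto_nhds_unique hR h0
  intro r x
  by_contra hrx
  exact (lt_irrefl (0 : ℝ)) (hRsq ▸ hpos ⟨r, x, hrx⟩)

/-- **The zero-residue slice of K1 holds unconditionally** (a rung of `NoSurvivingDSS R a` with no
threshold and no survival hypothesis used): on every table of the class `E₂(R)` — indeed on every
cancelling table — an admissible DSS wave with residue level `0` is trivial, whatever `ε₀`, `a`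
and the delay.  What K1 adds is exactly the positive-residue, `(S_a)`-surviving case.
[cite: Tao2016AveragedNS, §4 (4.2)–(4.3), Lemma 4.1 (4.9)–(4.10); cell theorem B (rung of K1)] -/
theorem noSurvivingDSS_rung_zeroResidue (R a ε₀ : ℝ)
    (α : Fin 4 → Fin 4 → Fin 4 → ℤ × ℤ × ℤ → ℝ) (hα : InTableClass R α)
    (q : ℕ) (π : Equiv.Perm (Fin q)) (T : ℝ) (Φ : Fin q → ℝ → Em 4)
    (h : IsDSSWave ε₀ α π T Φ) (_hS : Surviving a ε₀ T)
    (h0 : Tendsto (wEnergy 1 Φ) atTop (𝓝 0)) : ∀ r x, Φ r x = 0 :=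
  h.eq_zero_of_residue_zero hα.2.1 h0

end DSSWaves

end TaoCascade

end Literature.Analysis.FluidPDE

end
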